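import Literature.Probability.Percolation.RhombicTilingPlanarityII
import Literature.Probability.Percolation.IsoradialDualCrossings
import HarnessLib

/-!
# Planarity of rhombic tilings, III: fault lines — no T-junctions, corner consistency

Topic `Literature/Probability/Percolation`. Sequel to `RhombicTilingPlanarity` (I: one rhombus,
disjoint interiors) and `RhombicTilingPlanarityII` (II: the tile across a side, even side-loops,
corner consistency *given* no T-junctions). Let `emb : RhombicEmbedding G F` be isoradial
(`IsIsoradial`), satisfy the tiling condition (`IsRhombicTiling`) and the bounded-angles property
(`HasBoundedAngles ε`, `0 < ε`), and let `G` be preconnected. This file removes the last side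
condition: the tiling has **no T-junctions** (`noTJunction_of_preconnected`), hence
(`RhombicTilingPlanarityII.z_ne_c_of_noTJunction`) it is **corner consistent**: `emb.z v ≠
emb.c (emb.leftFace d)` for every vertex `v` and dart `d` (`z_ne_c`) — the hypothesis `hcons` of
`gm_theta_critical_eq_zero_of_dual_boxCrossing` (`IsoradialDualCrossings`), which is discharged
in `gm_theta_critical_eq_zero_of_dual_boxCrossing'`. Grimmett–Manolescu (PTRF 159 (2014) =
arXiv:1204.0505, §4.1) use these properties of the diamond graph `G^◇` of an isoradial graph
throughout ("`G^◇` is a rhombic tiling", `G` and `G*` its two colour classes); for the loose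
predicates of the tree they have to be proved, and they fail without connectedness (part I,
module docstring).

The argument (fault lines). Suppose a corner `q₀` of a rhombus lies in the open side
`(x, x + u)` of another rhombus `K_B ⊆ {s_B h ≥ 0}`, `h X = u × (X - q₀)`.
* §2 **Step** (`exists_tile_continuing_fault`): some rhombus has the corner `q₀`, the side
  `{q₀, q₀ + u}`, and lies in `{s_B h ≤ 0}`. (Cover the points `q₀ + t u - s_B t² iu`, `t → 0⁺`,
  by one rhombus `K₁` — finitely many rhombi meet a disc; `q₀ ∈ ∂K₁`; `q₀` cannot be on an open
  side of `K₁`, else `K₁` and the rhombus cornered at `q₀` overlap; so `q₀` is a corner of `K₁`,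
  whose tangent cone at `q₀` contains `u` and lies weakly across the line, forcing a side along
  `u`; a rhombus with a side on the line lying locally across lies globally across.)
* §3 **March** (`fault_march`): iterating, upper rhombi (in `{s_B h ≤ 0}`) with sides
  `{q₀ + k u, q₀ + (k+1) u}` and lower rhombi with sides `{x + (k+1) u, x + (k+2) u}` for all
  `k ∈ ℕ`, in both directions `±u`. Hence (`false_of_tJunction`): every point of the line lies on
  an upper side and on a lower side, one of them open (the breakpoints `q₀ + ℤu`, `x + ℤu` are
  disjoint as `q₀ - x = θ u`, `0 < θ < 1`); no interior point of any rhombus is on the line; by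
  convexity every rhombus is upper or lower; no point is a corner of an upper and of a lower
  rhombus (the two would overlap the rhombus owning the open side there); so the rhombi at a
  vertex are all upper or all lower, this propagates along edges, and `G.Preconnected` makes
  every rhombus upper — including the lower rhombus `K_B`, whose centre would be on the line.
* §1 supplies bookkeeping: `RhombicEmbedding.cornerSet`, `RhombicPlanarity.IsUnitQuad`, the
  rhombus read from a side (`exists_isUnitQuad_of_mem_tileSides`) or a corner
  (`exists_isUnitQuad_of_mem_cornerSet`), corners are never on open sides.
* §4 Applications without `hcons`: `gm_theta_critical_eq_zero_of_dual_boxCrossing'` (θ = 0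
  from the box-crossing property of the dual, Theorem 4 (b) of the paper along its printed
  proof, modulo the box-crossing theorem for `G*`) and the two duality exclusion theorems
  ("a primal open crossing blocks every dual-open crossing across it").
* §5 `existsUnique_other_edge_of_mem_sides`: every combinatorial side `(v, f)` of a rhombus is a
  side of exactly one other rhombus (edge-to-edge + corner consistency + injectivity of `z`,
  `c`) — the fact that lets de Bruijn's train tracks (§4.2 of the paper) be continued.

## References

* G. R. Grimmett, I. Manolescu, *Bond percolation on isoradial graphs: criticality and
  universality*, PTRF 159 (2014) 273–327, arXiv:1204.0505, §2.1, §2.2 (2.4), §3 Theorem 4 (b),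
  §4.1 (the diamond graph is a rhombic tiling; `G`, `G*` read off it).
* R. Kenyon, J.-M. Schlenker, *Rhombic embeddings of planar quad-graphs*, Trans. AMS 357 (2005),
  §1.
-/

noncomputable section

namespace Literature.Probability.Percolation

open Complex ComplexConjugate Metric Set Filter Topology
open Literature.Probability.LatticeModels IsoradialCriticality Literature.Topology.PlaneTopology


/-! ### §1 Corners and sides of an edge; the rhombus read from a side or a corner -/

section FaultPrelim

open RhombicPlanarity

variable {V F : Type*} {G : SimpleGraph V} {emb : RhombicEmbedding G F} {ε : ℝ}

/-- The corner set of the rhombus of an edge. [folklore] -/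
def _root_.Literature.Probability.LatticeModels.RhombicEmbedding.cornerSet
    (emb : RhombicEmbedding G F) (e : G.edgeSet) : Set ℂ :=
  {emb.z (RhombicEmbedding.refDart e).fst, emb.z (RhombicEmbedding.refDart e).snd,
    emb.c (emb.leftFace (RhombicEmbedding.refDart e)), emb.c (emb.rightFace (RhombicEmbedding.refDart e))}

/-- The corner set read from any dart over the edge. [folklore] -/
theorem cornerSet_dart (hiso : emb.IsIsoradial) (d : G.Dart) :
    emb.cornerSet ⟨d.edge, d.edge_mem⟩ =
      {emb.z d.fst, emb.z d.snd, emb.c (emb.leftFace d), emb.c (emb.rightFace d)} := by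
  unfold RhombicEmbedding.cornerSet
  have h1 := hiso.leftFace_symm d
  have h2 : emb.rightFace d.symm = emb.leftFace d := by
    have := hiso.leftFace_symm d.symm; rw [SimpleGraph.Dart.symm_symm] at this; exact this.symm
  rcases refDart_eq_or d with h | h <;> rw [h]
  ext X
  simp only [SimpleGraph.Dart.symm_toProd, Prod.fst_swap, Prod.snd_swap, h1, h2, mem_insert_iff,
    mem_singleton_iff]
  tauto

/-- Corners in terms of a dart and a face choice. [folklore] -/
theorem mem_cornerSet_dart_iff (hiso : emb.IsIsoradial) (d : G.Dart) (b : Bool) (X : ℂ) :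
    X ∈ emb.cornerSet ⟨d.edge, d.edge_mem⟩ ↔
      X = emb.z d.fst ∨ X = emb.c (emb.dartFace d b) ∨ X = emb.z d.snd ∨
        X = emb.c (emb.dartFace d (!b)) := by
  rw [cornerSet_dart hiso d]
  exact mem_corners_iff hiso d b X

/-- **Unit rhombus data** of four points `A, P, B, Q` (in the order: corner, neighbour, opposite
corner, other neighbour): diagonals bisect each other, non-degenerate, unit sides at `P`.
[folklore] -/
structure RhombicPlanarity.IsUnitQuad (A P B Q : ℂ) : Prop where
  /-- The diagonals bisect each other. -/
  sum : P + Q = A + B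
  /-- The corner and the opposite corner differ. -/
  ne_AB : A ≠ B
  /-- The two neighbours differ. -/
  ne_PQ : P ≠ Q
  /-- Unit side. -/
  norm_AP : ‖A - P‖ = 1
  /-- Unit side. -/
  norm_BP : ‖B - P‖ = 1

namespace RhombicPlanarity.IsUnitQuad

variable {A P B Q : ℂ}

/-- The other two sides are unit as well. [folklore] -/
theorem norm_AQ (h : IsUnitQuad A P B Q) : ‖A - Q‖ = 1 := by
  have : A - Q = -(B - P) := by linear_combination (-1:ℂ) * h.sum
  rw [this, norm_neg, h.norm_BP]

/-- The other two sides are unit as well. [folklore] -/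
theorem norm_BQ (h : IsUnitQuad A P B Q) : ‖B - Q‖ = 1 := by
  have : B - Q = -(A - P) := by linear_combination (-1:ℂ) * h.sum
  rw [this, norm_neg, h.norm_AP]

/-- Swapping the two neighbours. [folklore] -/
theorem swap_PQ (h : IsUnitQuad A P B Q) : IsUnitQuad A Q B P :=
  ⟨by linear_combination h.sum, h.ne_AB, h.ne_PQ.symm, h.norm_AQ, h.norm_BQ⟩

/-- Reading the rhombus from the opposite corner. [folklore] -/
theorem swap_AB (h : IsUnitQuad A P B Q) : IsUnitQuad B P A Q :=
  ⟨by linear_combination h.sum, h.ne_AB.symm, h.ne_PQ, h.norm_BP, h.norm_AP⟩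

/-- Reading the rhombus from a neighbour corner. [folklore] -/
theorem rotate (h : IsUnitQuad A P B Q) : IsUnitQuad P A Q B :=
  ⟨by linear_combination (-1 : ℂ) * h.sum, h.ne_PQ, h.ne_AB, by rw [norm_sub_rev, h.norm_AP],
    by rw [norm_sub_rev, h.norm_AQ]⟩

/-- The corner `A` is not on the open side `(A, P)`. [folklore] -/
theorem left_not_mem_openSegment (h : IsUnitQuad A P B Q) : A ∉ openSegment ℝ A P := by
  intro hA
  obtain ⟨θ, hθ0, -, hθ⟩ := exists_coord_of_mem_openSegment hA
  have : (θ : ℂ) * (P - A) = 0 := by linear_combination -hθ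
  rcases mul_eq_zero.1 this with h1 | h1
  · exact hθ0.ne' (by exact_mod_cast h1)
  · have hAP := h.norm_AP
    rw [show A - P = -(P - A) by ring, h1, norm_neg, norm_zero] at hAP
    exact zero_ne_one hAP

/-- The corner `P` is not on the open side `(A, P)`. [folklore] -/
theorem right_not_mem_openSegment (h : IsUnitQuad A P B Q) : P ∉ openSegment ℝ A P := by
  intro hP
  obtain ⟨θ, -, hθ1, hθ⟩ := exists_coord_of_mem_openSegment hP
  have : ((1 - θ : ℝ) : ℂ) * (P - A) = 0 := by push_cast; linear_combination hθ
  rcases mul_eq_zero.1 this with h1 | h1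
  · have : (1 - θ : ℝ) = 0 := by exact_mod_cast h1
    linarith
  · have hAP := h.norm_AP
    rw [show A - P = -(P - A) by ring, h1, norm_neg, norm_zero] at hAP
    exact zero_ne_one hAP

/-- No corner lies on the open side `(A, P)`. [folklore] -/
theorem not_mem_openSegment_of_corner (h : IsUnitQuad A P B Q) {X : ℂ}
    (hX : X ∈ ({A, P, B, Q} : Set ℂ)) : X ∉ openSegment ℝ A P := by
  simp only [mem_insert_iff, mem_singleton_iff] at hX
  rcases hX with rfl | rfl | rfl | rfl
  · exact h.left_not_mem_openSegment
  · exact h.right_not_mem_openSegment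
  · intro hX
    exact (not_mem_other_sides_of_mem_openSegment h.sum h.ne_AB h.ne_PQ h.norm_AP h.norm_BP hX).1
      (right_mem_segment ℝ _ _)
  · intro hX
    exact (not_mem_other_sides_of_mem_openSegment h.sum h.ne_AB h.ne_PQ h.norm_AP h.norm_BP
      hX).2.2 (left_mem_segment ℝ _ _)

end RhombicPlanarity.IsUnitQuad

/-- The rhombus data of a dart as an `IsUnitQuad`. [folklore] -/
theorem isUnitQuad_dart (hiso : emb.IsIsoradial) (d : G.Dart) (b : Bool) :
    IsUnitQuad (emb.z d.fst) (emb.c (emb.dartFace d b)) (emb.z d.snd) (emb.c (emb.dartFace d (!b))) := by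
  obtain ⟨hsum, hAB, hPQ, hAP, hBP⟩ := dart_quad' hiso d b
  exact ⟨hsum, hAB, hPQ, hAP, hBP⟩

/-- **The rhombus read from one of its sides.** If `{a, a'}` is a side of the rhombus of `e`,
the rhombus is the unit rhombus with corner `a`, neighbour `a'`, and its corner set is
`{a, a', B', Q'}`. [folklore] -/
theorem exists_isUnitQuad_of_mem_tileSides (hiso : emb.IsIsoradial) {e : G.edgeSet} {a a' : ℂ}
    (h : s(a, a') ∈ emb.tileSides e) :
    ∃ B' Q' : ℂ, IsUnitQuad a a' B' Q' ∧ emb.rhombus e = convexHull ℝ {a, a', B', Q'} ∧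
      emb.cornerSet e = {a, a', B', Q'} := by
  obtain ⟨d, b, hde, hsd⟩ := (mem_tileSides_iff hiso e _).1 h
  have he : e = ⟨d.edge, d.edge_mem⟩ := Subtype.ext hde.symm
  subst he
  have hq := isUnitQuad_dart hiso d b
  rw [stdSide_mk] at hsd
  rcases Sym2.eq_iff.1 hsd with ⟨h1, h2⟩ | ⟨h1, h2⟩
  · subst h1; subst h2
    refine ⟨_, _, hq, rhombus_eq_quad hiso d b, ?_⟩
    rw [cornerSet_dart hiso d]
    ext X; cases b <;> simp [mem_insert_iff] <;> tauto
  · subst h1; subst h2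
    refine ⟨_, _, hq.rotate, ?_, ?_⟩
    · rw [rhombus_eq_quad hiso d b]
      congr 1; ext X; simp only [mem_insert_iff, mem_singleton_iff]; tauto
    · rw [cornerSet_dart hiso d]
      ext X; cases b <;> simp [mem_insert_iff] <;> tauto

/-- **The rhombus read from one of its corners.** [folklore] -/
theorem exists_isUnitQuad_of_mem_cornerSet (hiso : emb.IsIsoradial) {e : G.edgeSet} {q : ℂ}
    (h : q ∈ emb.cornerSet e) :
    ∃ N₁ O N₂ : ℂ, IsUnitQuad q N₁ O N₂ ∧ emb.rhombus e = convexHull ℝ {q, N₁, O, N₂} ∧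
      s(q, N₁) ∈ emb.tileSides e ∧ s(q, N₂) ∈ emb.tileSides e := by
  set d := RhombicEmbedding.refDart e with hd
  have he : (⟨d.edge, d.edge_mem⟩ : G.edgeSet) = e := edge_refDart e
  rw [← he] at h ⊢
  rw [mem_cornerSet_dart_iff hiso d true] at h
  have hq := isUnitQuad_dart hiso d true
  have hK := rhombus_eq_quad hiso d true
  have hsides := tileSides_dart hiso d true
  set A := emb.z d.fst
  set P := emb.c (emb.dartFace d true)
  set B := emb.z d.snd
  set Q := emb.c (emb.dartFace d (!true))
  have hperm : ∀ X Y Z W : ℂ, ({X, Y, Z, W} : Set ℂ) = {X, Y, Z, W} := fun _ _ _ _ => rfl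
  rcases h with rfl | rfl | rfl | rfl
  · refine ⟨P, B, Q, hq, hK, ?_, ?_⟩ <;> rw [hsides] <;> simp
  · refine ⟨A, Q, B, hq.rotate, ?_, ?_, ?_⟩
    · rw [hK]; congr 1; ext X; simp only [mem_insert_iff, mem_singleton_iff]; tauto
    · rw [hsides]; simp [Sym2.eq_swap]
    · rw [hsides]; simp [Sym2.eq_swap]
  · refine ⟨P, A, Q, hq.swap_AB, ?_, ?_, ?_⟩
    · rw [hK]; congr 1; ext X; simp only [mem_insert_iff, mem_singleton_iff]; tauto
    · rw [hsides]; simp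
    · rw [hsides]; simp
  · refine ⟨A, P, B, hq.swap_PQ.rotate, ?_, ?_, ?_⟩
    · rw [hK]; congr 1; ext X; simp only [mem_insert_iff, mem_singleton_iff]; tauto
    · rw [hsides]; simp [Sym2.eq_swap]
    · rw [hsides]; simp [Sym2.eq_swap]

/-- The endpoints of a side are corners. [folklore] -/
theorem mem_cornerSet_of_mem_tileSides (hiso : emb.IsIsoradial) {e : G.edgeSet} {a a' : ℂ}
    (h : s(a, a') ∈ emb.tileSides e) : a ∈ emb.cornerSet e ∧ a' ∈ emb.cornerSet e := by
  obtain ⟨B', Q', -, -, hc⟩ := exists_isUnitQuad_of_mem_tileSides hiso h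
  rw [hc]; exact ⟨by simp, by simp⟩

/-- Corners lie in the rhombus. [folklore] -/
theorem cornerSet_subset_rhombus (hiso : emb.IsIsoradial) (e : G.edgeSet) :
    emb.cornerSet e ⊆ emb.rhombus e := by
  intro q hq
  obtain ⟨N₁, O, N₂, -, hK, -⟩ := exists_isUnitQuad_of_mem_cornerSet hiso hq
  rw [hK]; exact subset_convexHull ℝ _ (by simp)

/-- A side lies in the rhombus. [folklore] -/
theorem segment_subset_rhombus_of_mem_tileSides (hiso : emb.IsIsoradial) {e : G.edgeSet}
    {a a' : ℂ} (h : s(a, a') ∈ emb.tileSides e) : segment ℝ a a' ⊆ emb.rhombus e := by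
  obtain ⟨B', Q', -, hK, -⟩ := exists_isUnitQuad_of_mem_tileSides hiso h
  rw [hK]; exact segment_subset_convexHull (by simp) (by simp)

/-- **No corner of a rhombus lies on one of its own open sides.** [folklore] -/
theorem not_mem_openSegment_of_mem_cornerSet (hiso : emb.IsIsoradial) {e : G.edgeSet}
    {a a' q : ℂ} (h : s(a, a') ∈ emb.tileSides e) (hq : q ∈ emb.cornerSet e) :
    q ∉ openSegment ℝ a a' := by
  obtain ⟨B', Q', hquad, -, hc⟩ := exists_isUnitQuad_of_mem_tileSides hiso h
  rw [hc] at hq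
  exact hquad.not_mem_openSegment_of_corner hq

/-- An open set is not contained in a line: it contains a point off the line `{h = 0}`,
`h X = u × (X - q₀)`, `u ≠ 0`. [folklore] -/
theorem exists_cross_ne_zero_of_isOpen {U : Set ℂ} (hU : IsOpen U) {Y : ℂ} (hY : Y ∈ U) {u : ℂ}
    (hu : ‖u‖ = 1) (q₀ : ℂ) : ∃ Z ∈ U, cross u (Z - q₀) ≠ 0 := by
  by_cases h0 : cross u (Y - q₀) = 0
  · obtain ⟨r, hr, hball⟩ := Metric.isOpen_iff.1 hU Y hY
    refine ⟨Y + ((r / 2 : ℝ) : ℂ) * (I * u), hball ?_, ?_⟩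
    · rw [mem_ball, dist_eq_norm, add_sub_cancel_left, norm_mul, Complex.norm_real, norm_mul,
        Complex.norm_I, hu, Real.norm_eq_abs, abs_of_pos (by positivity)]; linarith
    · have : Y + ((r / 2 : ℝ) : ℂ) * (I * u) - q₀ = (Y - q₀) + ((r / 2 : ℝ) : ℂ) * (I * u) := by ring
      rw [this, cross_add_right, h0, cross_ofReal_mul_right, cross_self_I_mul, hu]
      norm_num; exact hr.ne'
  · exact ⟨Y, hY, h0⟩

end FaultPrelim

/-! ### §2 The step of the fault line -/

section FaultStep

open RhombicPlanarity

variable {V F : Type*} {G : SimpleGraph V} {emb : RhombicEmbedding G F} {ε : ℝ}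

/-- Points of a segment through points of the line `{h = 0}` are on the line. [folklore] -/
theorem cross_eq_zero_of_mem_segment {u q₀ x y q : ℂ} (hx : cross u (x - q₀) = 0)
    (hy : cross u (y - q₀) = 0) (hq : q ∈ segment ℝ x y) : cross u (q - q₀) = 0 := by
  obtain ⟨θ, -, -, rfl⟩ := exists_coord_of_mem_segment hq
  have : x + (θ : ℂ) * (y - x) - q₀ = (x - q₀) + (θ : ℂ) * ((y - q₀) - (x - q₀)) := by ring
  rw [this, cross_add_right, hx, cross_ofReal_mul_right, cross_sub_right, hy, hx]; ring

/-- **The half-disc of a rhombus with a side on the line.** If the rhombus of `e` lies in the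
closed half-plane `{s h ≥ 0}` (`s = ±1`, `h X = u × (X - q₀)`) and has a side `{x, x + u}` on the
line `{h = 0}`, then near each point of that open side it contains the whole half-disc
`{s h ≥ 0}`. [folklore] -/
theorem exists_halfDisc_of_side_on_line (hiso : emb.IsIsoradial) {q₀ u : ℂ} (hu : ‖u‖ = 1)
    {s : ℝ} (hs : s = 1 ∨ s = -1) {e : G.edgeSet} {x q : ℂ}
    (hK : ∀ X ∈ emb.rhombus e, 0 ≤ s * cross u (X - q₀)) (hside : s(x, x + u) ∈ emb.tileSides e)
    (hx : cross u (x - q₀) = 0) (hq : q ∈ openSegment ℝ x (x + u)) :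
    ∃ δ > 0, ∀ X, dist X q < δ → 0 ≤ s * cross u (X - q₀) → X ∈ emb.rhombus e := by
  obtain ⟨B', Q', hquad, hKeq, -⟩ := exists_isUnitQuad_of_mem_tileSides hiso hside
  obtain ⟨δ, hδ, hhalf⟩ := exists_ball_inter_halfPlane_subset_quad hquad.sum hquad.ne_AB hquad.ne_PQ
    hquad.norm_AP hquad.norm_BP hq
  simp only [add_sub_cancel_left] at hhalf
  set σ : ℝ := cross u (Q' - x) with hσ
  have hσ0 : σ ≠ 0 := by
    have := cross_ne_zero_of_quad hquad.sum hquad.ne_AB hquad.ne_PQ hquad.norm_AP hquad.norm_BP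
    simpa using this
  have hs0 : s ≠ 0 := by rcases hs with rfl | rfl <;> norm_num
  have hs2 : s * s = 1 := by rcases hs with rfl | rfl <;> norm_num
  have hxu : cross u (x + u - q₀) = 0 := by
    have : x + u - q₀ = (x - q₀) + u := by ring
    rw [this, cross_add_right, hx, cross_self, add_zero]
  have hq0 : cross u (q - q₀) = 0 :=
    cross_eq_zero_of_mem_segment hx hxu (openSegment_subset_segment ℝ _ _ hq)
  have hrel : ∀ X, cross u (X - x) = cross u (X - q₀) := by
    intro X
    have : X - x = (X - q₀) - (x - q₀) := by ring
    rw [this, cross_sub_right, hx, sub_zero]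
  -- the sign of `σ` is the sign of `s`
  have hsσ : 0 < s * σ := by
    set X₂ : ℂ := q + ((δ / 2 * (σ / |σ|) : ℝ) : ℂ) * (I * u) with hX₂
    have hX₂h : cross u (X₂ - q₀) = δ / 2 * (σ / |σ|) := by
      have : X₂ - q₀ = (q - q₀) + ((δ / 2 * (σ / |σ|) : ℝ) : ℂ) * (I * u) := by rw [hX₂]; ring
      rw [this, cross_add_right, hq0, cross_ofReal_mul_right, cross_self_I_mul, hu]; ring
    have hX₂d : dist X₂ q < δ := by
      have hr : |δ / 2 * (σ / |σ|)| = δ / 2 := by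
        rw [abs_mul, abs_div σ, abs_abs, div_self (abs_ne_zero.2 hσ0), mul_one,
          abs_of_pos (by positivity : (0:ℝ) < δ / 2)]
      rw [dist_eq_norm, hX₂, add_sub_cancel_left, norm_mul, norm_mul, Complex.norm_I, hu,
        Complex.norm_real, Real.norm_eq_abs, hr]
      linarith
    have hX₂K : X₂ ∈ emb.rhombus e := by
      rw [hKeq]
      refine hhalf X₂ hX₂d ?_
      rw [hrel, hX₂h]
      have : δ / 2 * (σ / |σ|) * σ = δ / 2 * |σ| := by
        have hσ2 : σ * σ = |σ| * |σ| := (abs_mul_abs_self σ).symm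
        field_simp; linarith [hσ2]
      rw [this]; positivity
    have h1 := hK X₂ hX₂K
    rw [hX₂h] at h1
    by_contra hle
    have hne : s * σ ≠ 0 := mul_ne_zero hs0 hσ0
    have hlt : s * σ < 0 := lt_of_le_of_ne (not_lt.1 hle) hne
    have : s * (δ / 2 * (σ / |σ|)) < 0 := by
      have e1 : s * (δ / 2 * (σ / |σ|)) = (δ / 2) * (s * σ) / |σ| := by ring
      rw [e1]
      exact div_neg_of_neg_of_pos (mul_neg_of_pos_of_neg (by positivity) hlt) (abs_pos.2 hσ0)
    linarith
  refine ⟨δ, hδ, fun X hXd hXs => ?_⟩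
  rw [hKeq]
  refine hhalf X hXd ?_
  rw [hrel]
  have := mul_nonneg hXs hsσ.le
  have e1 : s * cross u (X - q₀) * (s * σ) = (s * s) * (cross u (X - q₀) * σ) := by ring
  rw [e1, hs2, one_mul] at this
  exact this

/-- **A different rhombus stays on the other side near the open side.** [folklore] -/
theorem cross_nonpos_of_ne (hiso : emb.IsIsoradial) (hrh : emb.IsRhombicTiling) {q₀ u : ℂ}
    {s : ℝ} {e e' : G.edgeSet} {q : ℂ} {δ : ℝ}
    (hhalf : ∀ X, dist X q < δ → 0 ≤ s * cross u (X - q₀) → X ∈ emb.rhombus e) (hne : e' ≠ e)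
    {Y : ℂ} (hY : Y ∈ emb.rhombus e') (hYq : dist Y q < δ) : s * cross u (Y - q₀) ≤ 0 := by
  refine le_of_not_gt fun hpos => ?_
  set U : Set ℂ := ball q δ ∩ {X | 0 < s * cross u (X - q₀)} with hU
  have hUo : IsOpen U :=
    isOpen_ball.inter (isOpen_lt continuous_const (continuous_const.mul (continuous_cross_right u q₀)))
  have hUsub : U ⊆ emb.rhombus e := fun X hX => hhalf X (mem_ball.1 hX.1) (le_of_lt hX.2)
  exact hne (edge_eq_of_isOpen_subset_rhombus hiso hrh hUo hUsub ⟨mem_ball.2 hYq, hpos⟩ hY)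

/-- **Side flip.** A rhombus with a side `{q, q + u}` on the line which, near `q`, stays in the
closed half-plane `{s h ≤ 0}` lies globally in `{s h ≤ 0}`. [folklore] -/
theorem sign_flip_of_side_on_line (hiso : emb.IsIsoradial) {q₀ u : ℂ} (hu : ‖u‖ = 1) {s : ℝ}
    (hs : s = 1 ∨ s = -1) {e : G.edgeSet} {q : ℂ} {δ : ℝ} (hδ : 0 < δ)
    (hside : s(q, q + u) ∈ emb.tileSides e) (hq : cross u (q - q₀) = 0)
    (hfar : ∀ Y ∈ emb.rhombus e, dist Y q < δ → s * cross u (Y - q₀) ≤ 0) :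
    ∀ X ∈ emb.rhombus e, 0 ≤ -s * cross u (X - q₀) := by
  obtain ⟨B', Q', hquad, hKeq, -⟩ := exists_isUnitQuad_of_mem_tileSides hiso hside
  set σ : ℝ := cross u (Q' - q) with hσ
  have hσ0 : σ ≠ 0 := by
    have := cross_ne_zero_of_quad hquad.sum hquad.ne_AB hquad.ne_PQ hquad.norm_AP hquad.norm_BP
    simpa using this
  have hs2 : s * s = 1 := by rcases hs with rfl | rfl <;> norm_num
  have hrel : ∀ X, cross u (X - q) = cross u (X - q₀) := by
    intro X
    have : X - q = (X - q₀) - (q - q₀) := by ring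
    rw [this, cross_sub_right, hq, sub_zero]
  -- the rhombus lies in `{h σ ≥ 0}`
  have hglob : ∀ X ∈ emb.rhombus e, 0 ≤ cross u (X - q₀) * σ := by
    intro X hX
    rw [hKeq] at hX
    have := cross_mul_cross_nonneg_of_mem hquad.sum hX
    simp only [add_sub_cancel_left] at this
    rwa [hrel] at this
  -- the sign of `σ` is `-s`
  have hsσ : s * σ < 0 := by
    rcases lt_trichotomy (s * σ) 0 with h | h | h
    · exact h
    · exfalso
      rcases mul_eq_zero.1 h with h | h
      · rcases hs with rfl | rfl <;> norm_num at h
      · exact hσ0 h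
    · exfalso
      -- then the rhombus near `q` lies in the line: impossible
      have hqK : q ∈ emb.rhombus e := by rw [hKeq]; exact subset_convexHull ℝ _ (by simp)
      obtain ⟨Y, hYb, hYi⟩ := exists_mem_interior_rhombus_of_isOpen hiso isOpen_ball
        (mem_ball_self hδ) hqK
      obtain ⟨Z, ⟨hZi, hZb⟩, hZ⟩ := exists_cross_ne_zero_of_isOpen (isOpen_interior.inter isOpen_ball)
        ⟨hYi, hYb⟩ hu q₀
      have h1 := hfar Z (interior_subset hZi) (mem_ball.1 hZb)
      have h2 := hglob Z (interior_subset hZi)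
      have h3 : 0 ≤ s * cross u (Z - q₀) := by
        have := mul_nonneg h2 h.le
        have e1 : cross u (Z - q₀) * σ * (s * σ) = (s * cross u (Z - q₀)) * (σ * σ) := by ring
        rw [e1] at this
        exact nonneg_of_mul_nonneg_left this (mul_self_pos.2 hσ0)
      have h4 : s * cross u (Z - q₀) = 0 := le_antisymm h1 h3
      rcases mul_eq_zero.1 h4 with h5 | h5
      · rcases hs with rfl | rfl <;> norm_num at h5
      · exact hZ h5
  intro X hX
  have := mul_nonneg (hglob X hX) (neg_nonneg.2 hsσ.le)
  have e1 : cross u (X - q₀) * σ * -(s * σ) = (-s * cross u (X - q₀)) * (σ * σ) := by ring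
  rw [e1] at this
  exact nonneg_of_mul_nonneg_left this (mul_self_pos.2 hσ0)

/-- **The step of the fault line.** Let the rhombus of `eB` lie in `{s_B h ≥ 0}` and have a side
`{x, x + u}` on the line `{h = 0}`, and let `q` be a point of that open side which is a corner of
some rhombus (a T-junction at `q`). Then some rhombus has `q` as a corner, the side `{q, q + u}`,
and lies in `{s_B h ≤ 0}`: the fault continues along the line in the direction `u`.
(Cover the points `q + t u - s_B t² (iu)`, `t → 0⁺`, by one rhombus; it has `q` on its boundary,
not on an open side — else it and the rhombus cornered at `q` would overlap —, so at a corner,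
and its tangent cone at `q` contains `u` and lies in `{s_B h ≤ 0}`, forcing a side along `u`.)
[folklore] -/
theorem exists_tile_continuing_fault (hiso : emb.IsIsoradial) (hrh : emb.IsRhombicTiling)
    (hbap : emb.HasBoundedAngles ε) (hε : 0 < ε) (hnb : ∀ v : V, ∃ w, G.Adj v w) {q₀ u : ℂ}
    (hu : ‖u‖ = 1) {sB : ℝ} (hsB : sB = 1 ∨ sB = -1) {eB eA : G.edgeSet} {x q : ℂ}
    (hKB : ∀ X ∈ emb.rhombus eB, 0 ≤ sB * cross u (X - q₀)) (hgs : s(x, x + u) ∈ emb.tileSides eB)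
    (hx : cross u (x - q₀) = 0) (hq : q ∈ openSegment ℝ x (x + u)) (hqA : q ∈ emb.cornerSet eA) :
    ∃ e₁ : G.edgeSet, q ∈ emb.cornerSet e₁ ∧ s(q, q + u) ∈ emb.tileSides e₁ ∧
      ∀ X ∈ emb.rhombus e₁, 0 ≤ -sB * cross u (X - q₀) := by
  have hsB0 : sB ≠ 0 := by rcases hsB with rfl | rfl <;> norm_num
  have hsB2 : sB * sB = 1 := by rcases hsB with rfl | rfl <;> norm_num
  have hIu : cross u (I * u) = 1 := by rw [cross_self_I_mul, hu]; norm_num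
  set h : ℂ → ℝ := fun X => cross u (X - q₀) with hh
  have hxu : cross u (x + u - q₀) = 0 := by
    have : x + u - q₀ = (x - q₀) + u := by ring
    rw [this, cross_add_right, hx, cross_self, add_zero]
  have hq0 : cross u (q - q₀) = 0 :=
    cross_eq_zero_of_mem_segment hx hxu (openSegment_subset_segment ℝ _ _ hq)
  have hrelq : ∀ X, cross u (X - q) = cross u (X - q₀) := by
    intro X
    have : X - q = (X - q₀) - (q - q₀) := by ring
    rw [this, cross_sub_right, hq0, sub_zero]
  -- A. the half-disc of `eB` at `q`
  obtain ⟨δ₀, hδ₀, hhalfB⟩ := exists_halfDisc_of_side_on_line hiso hu hsB hKB hgs hx hq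
  have hqB : q ∈ emb.rhombus eB :=
    segment_subset_rhombus_of_mem_tileSides hiso hgs (openSegment_subset_segment ℝ _ _ hq)
  have hqKA : q ∈ emb.rhombus eA := cornerSet_subset_rhombus hiso eA hqA
  -- B. `eA ≠ eB`
  have hAB : eA ≠ eB := by
    rintro rfl; exact not_mem_openSegment_of_mem_cornerSet hiso hgs hqA hq
  -- C. the test points
  set t : ℕ → ℝ := fun n => 1 / ((n : ℝ) + 2) with ht
  have htpos : ∀ n, 0 < t n := fun n => by rw [ht]; positivity
  have htle : ∀ n, t n ≤ 1 / 2 := fun n => by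
    rw [ht]; rw [div_le_div_iff_of_pos_left one_pos (by positivity) (by norm_num)]
    linarith [(Nat.cast_nonneg n : (0:ℝ) ≤ n)]
  set X : ℕ → ℂ := fun n => q + (t n : ℂ) * u - ((sB * t n ^ 2 : ℝ) : ℂ) * (I * u) with hX
  have hXh : ∀ n, cross u (X n - q₀) = -(sB * t n ^ 2) := by
    intro n
    have : X n - q₀ = (q - q₀) + (t n : ℂ) * u - ((sB * t n ^ 2 : ℝ) : ℂ) * (I * u) := by
      rw [hX]; ring
    rw [this, cross_sub_right, cross_add_right, hq0, cross_ofReal_mul_right, cross_self,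
      cross_ofReal_mul_right, hIu]; ring
  have hXout : ∀ n, X n ∉ emb.rhombus eB := by
    intro n hn
    have h1 := hKB (X n) hn
    rw [hXh] at h1
    have : sB * -(sB * t n ^ 2) = -(t n ^ 2) := by
      have e1 : sB * -(sB * t n ^ 2) = -((sB * sB) * t n ^ 2) := by ring
      rw [e1, hsB2, one_mul]
    rw [this] at h1
    have := pow_pos (htpos n) 2
    linarith
  have hXdist : ∀ n, dist (X n) q ≤ 2 * t n := by
    intro n
    rw [dist_eq_norm]
    have : X n - q = (t n : ℂ) * u - ((sB * t n ^ 2 : ℝ) : ℂ) * (I * u) := by rw [hX]; ring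
    rw [this]
    calc ‖(t n : ℂ) * u - ((sB * t n ^ 2 : ℝ) : ℂ) * (I * u)‖
        ≤ ‖(t n : ℂ) * u‖ + ‖((sB * t n ^ 2 : ℝ) : ℂ) * (I * u)‖ := norm_sub_le _ _
      _ = t n + t n ^ 2 := by
        rw [norm_mul, Complex.norm_real, hu, mul_one, Real.norm_eq_abs, abs_of_pos (htpos n),
          norm_mul, norm_mul, Complex.norm_I, hu, Complex.norm_real, Real.norm_eq_abs, abs_mul,
          abs_pow, abs_of_pos (htpos n), one_mul, mul_one]
        rcases hsB with h1 | h1 <;> rw [h1] <;> norm_num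
      _ ≤ 2 * t n := by nlinarith [htpos n, htle n]
  have hXbd : ∀ n, ‖X n - q‖ ≤ 1 := by
    intro n; rw [← dist_eq_norm]; linarith [hXdist n, htle n]
  -- D. one rhombus contains infinitely many test points
  obtain ⟨e₁, hfreq⟩ := exists_rhombus_frequently hiso hrh hbap hε hnb hXbd
  -- E. it is not `eB`, and it contains `q`
  have h1B : e₁ ≠ eB := by
    rintro rfl; obtain ⟨n, -, hn⟩ := hfreq 0; exact hXout n hn
  have hq1 : q ∈ emb.rhombus e₁ := by
    have : q ∈ closure (emb.rhombus e₁) := by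
      rw [Metric.mem_closure_iff]
      intro δ hδ
      obtain ⟨N, hN⟩ := exists_nat_gt (2 / δ)
      obtain ⟨n, hNn, hn⟩ := hfreq N
      refine ⟨X n, hn, ?_⟩
      rw [dist_comm]
      refine lt_of_le_of_lt (hXdist n) ?_
      rw [ht]
      have hN' : 2 / δ < (n : ℝ) + 2 := by
        have : (N : ℝ) ≤ n := by exact_mod_cast hNn
        linarith
      rw [mul_one_div, div_lt_iff₀ (by positivity)]
      calc (2 : ℝ) = 2 / δ * δ := by field_simp
        _ < (n + 2) * δ := mul_lt_mul_of_pos_right hN' hδ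
        _ = δ * (n + 2) := by ring
    exact (isClosed_rhombus e₁).closure_subset this
  -- F. near `q`, `e₁` and `eA` lie in `{s_B h ≤ 0}`
  have hfar1 : ∀ Y ∈ emb.rhombus e₁, dist Y q < δ₀ → sB * cross u (Y - q₀) ≤ 0 :=
    fun Y hY hYq => cross_nonpos_of_ne hiso hrh hhalfB h1B hY hYq
  have hfarA : ∀ Y ∈ emb.rhombus eA, dist Y q < δ₀ → sB * cross u (Y - q₀) ≤ 0 :=
    fun Y hY hYq => cross_nonpos_of_ne hiso hrh hhalfB hAB hY hYq
  -- G. `q` is a boundary point of `e₁`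
  have hqi : q ∉ interior (emb.rhombus e₁) := fun hqi =>
    h1B (edge_eq_of_isOpen_subset_rhombus hiso hrh isOpen_interior interior_subset hqi hqB).symm
  -- H. so `q` is on a standard side of a dart over `e₁`
  set d₀ := RhombicEmbedding.refDart e₁ with hd₀
  have he₁ : (⟨d₀.edge, d₀.edge_mem⟩ : G.edgeSet) = e₁ := edge_refDart e₁
  obtain ⟨d₁, b₁, hd₁e, hqs⟩ := exists_std_side_of_not_mem_interior hiso d₀ (by rw [he₁]; exact hq1)
    (by rw [he₁]; exact hqi)
  have he₁' : (⟨d₁.edge, d₁.edge_mem⟩ : G.edgeSet) = e₁ := (Subtype.ext hd₁e).trans he₁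
  have hside₁ : s(emb.z d₁.fst, emb.c (emb.dartFace d₁ b₁)) ∈ emb.tileSides e₁ := by
    rw [← he₁']; exact stdSide_mem_tileSides hiso d₁ b₁
  set A₁ := emb.z d₁.fst with hA₁
  set P₁ := emb.c (emb.dartFace d₁ b₁) with hP₁
  -- I. `q` is an endpoint of that side
  have hqcorner : q ∈ emb.cornerSet e₁ := by
    rcases Mesh.eq_or_eq_or_mem_openSegment hqs with hqe | hqe | hqo
    · rw [hqe]; exact (mem_cornerSet_of_mem_tileSides hiso hside₁).1
    · rw [hqe]; exact (mem_cornerSet_of_mem_tileSides hiso hside₁).2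
    · -- `q` in the open side of `e₁`: the rhombus of `eA` would overlap `e₁`
      exfalso
      obtain ⟨hsum₁, hAB₁, hPQ₁, hAP₁, hBP₁⟩ := dart_quad' hiso d₁ b₁
      set Q₁ := emb.c (emb.dartFace d₁ (!b₁)) with hQ₁
      set u₁ : ℂ := P₁ - A₁ with hu₁
      set σ₁ : ℝ := cross u₁ (Q₁ - A₁) with hσ₁
      have hc₁ : σ₁ ≠ 0 := cross_ne_zero_of_quad hsum₁ hAB₁ hPQ₁ hAP₁ hBP₁
      have hun₁ : ‖u₁‖ = 1 := by rw [hu₁, norm_sub_rev, hAP₁]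
      obtain ⟨δ₁, hδ₁, hhalf₁⟩ :=
        exists_ball_inter_halfPlane_subset_quad hsum₁ hAB₁ hPQ₁ hAP₁ hBP₁ hqo
      have hK₁eq : emb.rhombus e₁ = convexHull ℝ {A₁, P₁, emb.z d₁.snd, Q₁} := by
        rw [← he₁']; exact rhombus_eq_quad hiso d₁ b₁
      obtain ⟨β₁, -, -, hqβ⟩ := exists_coord_of_mem_openSegment hqo
      have hqu₁ : cross u₁ (q - A₁) = 0 := by
        rw [hqβ, add_sub_cancel_left, cross_ofReal_mul_right, cross_self, mul_zero]
      -- (i) the side is parallel to `u`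
      have hpar : cross u u₁ = 0 := by
        by_contra hne
        set η : ℝ := min δ₀ δ₁ / 2 with hη
        have hηpos : 0 < η := by positivity
        have hηδ₀ : η < δ₀ := by have := min_le_left δ₀ δ₁; rw [hη]; linarith
        have hηδ₁ : η < δ₁ := by have := min_le_right δ₀ δ₁; rw [hη]; linarith
        have key : ∀ s' : ℝ, |s'| = η → s' * (sB * cross u u₁) ≤ 0 := by
          intro s' hs'
          set Y : ℂ := q + (s' : ℂ) * u₁ with hY
          have hYd : dist Y q = η := by
            rw [dist_eq_norm, hY, add_sub_cancel_left, norm_mul, Complex.norm_real, hun₁, mul_one,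
              Real.norm_eq_abs, hs']
          have hYin : Y ∈ emb.rhombus e₁ := by
            rw [hK₁eq]
            refine hhalf₁ Y (by rw [hYd]; exact hηδ₁) ?_
            have : cross u₁ (Y - A₁) = 0 := by
              have e1 : Y - A₁ = (q - A₁) + (s' : ℂ) * u₁ := by rw [hY]; ring
              rw [e1, cross_add_right, hqu₁, cross_ofReal_mul_right, cross_self]; ring
            rw [this, zero_mul]
          have h1 := hfar1 Y hYin (by rw [hYd]; exact hηδ₀)
          have e2 : cross u (Y - q₀) = s' * cross u u₁ := by
            have e1 : Y - q₀ = (q - q₀) + (s' : ℂ) * u₁ := by rw [hY]; ring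
            rw [e1, cross_add_right, hq0, cross_ofReal_mul_right, zero_add]
          rw [e2] at h1
          linarith
        have k1 := key η (abs_of_pos hηpos)
        have k2 := key (-η) (by rw [abs_neg, abs_of_pos hηpos])
        have : η * (sB * cross u u₁) = 0 := by nlinarith
        rcases mul_eq_zero.1 this with h0 | h0
        · exact hηpos.ne' h0
        · rcases mul_eq_zero.1 h0 with h0 | h0
          · exact hsB0 h0
          · exact hne h0
      -- (ii) `u₁ = ± u`, and `A₁` is on the line
      have hA₁0 : cross u (A₁ - q₀) = 0 := by
        have e1 : A₁ - q₀ = (q - q₀) - (β₁ : ℂ) * u₁ := by rw [hqβ]; ring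
        rw [e1, cross_sub_right, hq0, cross_ofReal_mul_right, hpar]; ring
      obtain ⟨lam, hlam, hul⟩ : ∃ lam : ℝ, (lam = 1 ∨ lam = -1) ∧ u₁ = (lam : ℂ) * u := by
        rcases dot_eq_one_or_neg_one hu hun₁ hpar with h1 | h1
        · exact ⟨1, Or.inl rfl, by rw [h1]; push_cast; ring⟩
        · exact ⟨-1, Or.inr rfl, by rw [h1]; push_cast; ring⟩
      have hlam0 : lam ≠ 0 := by rcases hlam with rfl | rfl <;> norm_num
      have hrel₁ : ∀ Y, cross u₁ (Y - A₁) = lam * cross u (Y - q₀) := by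
        intro Y
        have e1 : Y - A₁ = (Y - q₀) - (A₁ - q₀) := by ring
        rw [hul, cross_ofReal_mul_left, e1, cross_sub_right, hA₁0, sub_zero]
      -- (iii) the half-plane of `e₁` at `q` is the far one: `sB lam σ₁ < 0`
      have hsign : sB * lam * σ₁ < 0 := by
        rcases lt_trichotomy (sB * lam * σ₁) 0 with h0 | h0 | h0
        · exact h0
        · exfalso
          rcases mul_eq_zero.1 h0 with h0 | h0
          · rcases mul_eq_zero.1 h0 with h0 | h0
            · exact hsB0 h0
            · exact hlam0 h0
          · exact hc₁ h0
        · exfalso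
          set η : ℝ := min δ₀ δ₁ / 2 with hη
          have hηpos : 0 < η := by positivity
          have hηδ₀ : η < δ₀ := by have := min_le_left δ₀ δ₁; rw [hη]; linarith
          have hηδ₁ : η < δ₁ := by have := min_le_right δ₀ δ₁; rw [hη]; linarith
          set Y : ℂ := q + ((η * sB : ℝ) : ℂ) * (I * u) with hY
          have hYh : cross u (Y - q₀) = η * sB := by
            have e1 : Y - q₀ = (q - q₀) + ((η * sB : ℝ) : ℂ) * (I * u) := by rw [hY]; ring
            rw [e1, cross_add_right, hq0, cross_ofReal_mul_right, hIu]; ring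
          have hYd' : dist Y q = η := by
            rw [dist_eq_norm, hY, add_sub_cancel_left, norm_mul, norm_mul, Complex.norm_I, hu,
              Complex.norm_real, Real.norm_eq_abs, abs_mul, abs_of_pos hηpos]
            rcases hsB with h1 | h1 <;> rw [h1] <;> norm_num
          have hYd : dist Y q < min δ₀ δ₁ := by
            rw [hYd']; exact lt_min hηδ₀ hηδ₁
          have hYin : Y ∈ emb.rhombus e₁ := by
            rw [hK₁eq]
            refine hhalf₁ Y (lt_of_lt_of_le hYd (min_le_right _ _)) ?_
            rw [hrel₁, hYh, ← hσ₁]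
            have : lam * (η * sB) * σ₁ = η * (sB * lam * σ₁) := by ring
            rw [this]; positivity
          have h1 := hfar1 Y hYin (lt_of_lt_of_le hYd (min_le_left _ _))
          rw [hYh] at h1
          have : sB * (η * sB) = η := by
            have e1 : sB * (η * sB) = η * (sB * sB) := by ring
            rw [e1, hsB2, mul_one]
          rw [this] at h1
          linarith
      -- (iv) near `q`, the far closed half-disc lies in `e₁`
      have hfarDisc : ∀ Y, dist Y q < δ₁ → sB * cross u (Y - q₀) ≤ 0 → Y ∈ emb.rhombus e₁ := by
        intro Y hYd hYs
        rw [hK₁eq]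
        refine hhalf₁ Y hYd ?_
        rw [hrel₁, ← hσ₁]
        have := mul_nonneg_of_nonpos_of_nonpos hYs hsign.le
        have e1 : sB * cross u (Y - q₀) * (sB * lam * σ₁) =
            (sB * sB) * (lam * cross u (Y - q₀) * σ₁) := by ring
        rw [e1, hsB2, one_mul] at this
        exact this
      -- (v) the rhombus of `eA` meets the interior of `e₁`
      obtain ⟨Z, hZb, hZi⟩ := exists_mem_interior_rhombus_of_isOpen hiso isOpen_ball
        (mem_ball_self (lt_min hδ₀ hδ₁)) hqKA
      have hZd : dist Z q < min δ₀ δ₁ := mem_ball.1 hZb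
      have hZ1 : Z ∈ emb.rhombus e₁ := hfarDisc Z (lt_of_lt_of_le hZd (min_le_right _ _))
        (hfarA Z (interior_subset hZi) (lt_of_lt_of_le hZd (min_le_left _ _)))
      obtain ⟨Z', hZ'A, hZ'1⟩ := exists_mem_interior_rhombus_of_isOpen hiso isOpen_interior hZi hZ1
      have hA1 : eA = e₁ := by
        by_contra hne
        exact Set.disjoint_left.1 (hrh.disjoint_interior hne) hZ'A hZ'1
      rw [hA1] at hqA
      exact not_mem_openSegment_of_mem_cornerSet hiso hside₁ hqA hqo
  -- J. the rhombus `e₁` read from the corner `q`; tangent cone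
  obtain ⟨N₁, O, N₂, hquad, hK₁, hgs₁, hgs₂⟩ := exists_isUnitQuad_of_mem_cornerSet hiso hqcorner
  set v₁ : ℂ := N₁ - q with hv₁
  set v₂ : ℂ := N₂ - q with hv₂
  have hvn₁ : ‖v₁‖ = 1 := by rw [hv₁, norm_sub_rev, hquad.norm_AP]
  have hvn₂ : ‖v₂‖ = 1 := by rw [hv₂, norm_sub_rev, hquad.norm_AQ]
  set c₁₂ : ℝ := cross v₁ v₂ with hc₁₂
  have hc₁₂0 : c₁₂ ≠ 0 :=
    cross_ne_zero_of_quad hquad.sum hquad.ne_AB hquad.ne_PQ hquad.norm_AP hquad.norm_BP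
  -- (a) far-side constraints on the side vectors
  have hfarv : ∀ v : ℂ, (v = v₁ ∨ v = v₂) → sB * cross u v ≤ 0 := by
    intro v hv
    set η : ℝ := min 1 δ₀ / 2 with hη
    have hηpos : 0 < η := by positivity
    have hη1 : η ≤ 1 := by have := min_le_left 1 δ₀; rw [hη]; linarith
    have hηδ₀ : η < δ₀ := by have := min_le_right 1 δ₀; rw [hη]; linarith
    set Y : ℂ := q + (η : ℂ) * v with hY
    have hYin : Y ∈ emb.rhombus e₁ := by
      rw [hK₁, mem_convexHull_quad_iff hquad.sum]
      rcases hv with rfl | rfl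
      · exact ⟨η, ⟨hηpos.le, hη1⟩, 0, ⟨le_rfl, zero_le_one⟩, by rw [hY]; push_cast; ring⟩
      · exact ⟨0, ⟨le_rfl, zero_le_one⟩, η, ⟨hηpos.le, hη1⟩, by rw [hY]; push_cast; ring⟩
    have hvn : ‖v‖ = 1 := by rcases hv with rfl | rfl <;> assumption
    have hYd : dist Y q < δ₀ := by
      rw [dist_eq_norm, hY, add_sub_cancel_left, norm_mul, Complex.norm_real, hvn, mul_one,
        Real.norm_eq_abs, abs_of_pos hηpos]; exact hηδ₀
    have h1 := hfar1 Y hYin hYd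
    have e2 : cross u (Y - q₀) = η * cross u v := by
      have e1 : Y - q₀ = (q - q₀) + (η : ℂ) * v := by rw [hY]; ring
      rw [e1, cross_add_right, hq0, cross_ofReal_mul_right, zero_add]
    rw [e2] at h1
    have : η * (sB * cross u v) ≤ 0 := by linarith [h1, mul_left_comm sB η (cross u v)]
    by_contra hpos
    have := mul_pos hηpos (not_le.1 hpos)
    linarith
  -- (b) the tangent cone at `q` contains `u`: the coordinates of `u` are nonnegative
  set α : ℝ := cross u v₂ / c₁₂ with hα
  set β : ℝ := cross v₁ u / c₁₂ with hβ
  have hcoordX : ∀ n, X n ∈ emb.rhombus e₁ →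
      0 ≤ α - sB * t n * (cross (I * u) v₂ / c₁₂) ∧ 0 ≤ β - sB * t n * (cross v₁ (I * u) / c₁₂) := by
    intro n hn
    rw [hK₁, mem_convexHull_quad_iff hquad.sum] at hn
    obtain ⟨s₁, ⟨hs₁0, -⟩, s₂, ⟨hs₂0, -⟩, hXn⟩ := hn
    have hvec : (s₁ : ℂ) * v₁ + (s₂ : ℂ) * v₂ =
        (t n : ℂ) * (u - ((sB * t n : ℝ) : ℂ) * (I * u)) := by
      have : X n - q = (s₁ : ℂ) * v₁ + (s₂ : ℂ) * v₂ := by rw [hXn, hv₁, hv₂]; ring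
      rw [← this, hX]; push_cast; ring
    have h1 := congrArg (fun z => cross z v₂) hvec
    have h2 := congrArg (cross v₁) hvec
    simp only [cross_add_left, cross_ofReal_mul_left, cross_self, mul_zero, add_zero,
      cross_sub_left] at h1
    simp only [cross_add_right, cross_ofReal_mul_right, cross_self, mul_zero, zero_add,
      cross_sub_right] at h2
    -- `h1 : s₁ * c₁₂ = t n * (cross u v₂ - sB * t n * cross (I*u) v₂)`
    rw [← hc₁₂] at h1 h2
    have htn := htpos n
    constructor
    · have e1 : s₁ = t n * (α - sB * t n * (cross (I * u) v₂ / c₁₂)) := by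
        rw [hα]; field_simp; linear_combination h1
      have : 0 ≤ t n * (α - sB * t n * (cross (I * u) v₂ / c₁₂)) := by rw [← e1]; exact hs₁0
      exact (mul_nonneg_iff_of_pos_left htn).1 this
    · have e1 : s₂ = t n * (β - sB * t n * (cross v₁ (I * u) / c₁₂)) := by
        rw [hβ]; field_simp; linear_combination h2
      have : 0 ≤ t n * (β - sB * t n * (cross v₁ (I * u) / c₁₂)) := by rw [← e1]; exact hs₂0
      exact (mul_nonneg_iff_of_pos_left htn).1 this
  have hlimit : ∀ (a C : ℝ), (∀ N, ∃ n, N ≤ n ∧ 0 ≤ a - sB * t n * C) → 0 ≤ a := by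
    intro a C hfr
    by_contra ha
    have ha' : 0 < -a := by linarith [not_le.1 ha]
    -- choose `N` with `t N * |C| < -a`
    obtain ⟨N, hN⟩ := exists_nat_gt (|C| / (-a))
    obtain ⟨n, hNn, hn⟩ := hfr N
    have htn : t n ≤ t N := by
      rw [ht]; apply one_div_le_one_div_of_le (by positivity)
      have : (N : ℝ) ≤ n := by exact_mod_cast hNn
      linarith
    have hC : |C| < ((N : ℝ) + 2) * (-a) := by
      have h1 : |C| < (N : ℝ) * (-a) := (div_lt_iff₀ ha').1 hN
      nlinarith [abs_nonneg C]
    have htN : t N * |C| < -a := by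
      have e1 : t N * |C| = |C| / ((N : ℝ) + 2) := by rw [ht]; ring
      rw [e1, div_lt_iff₀ (by positivity)]
      linarith
    have hbound : |sB * t n * C| = t n * |C| := by
      rw [abs_mul, abs_mul, abs_of_pos (htpos n)]
      rcases hsB with h1 | h1 <;> rw [h1] <;> norm_num
    have h3 := neg_abs_le (sB * t n * C)
    rw [hbound] at h3
    have h4 : t n * |C| ≤ t N * |C| := mul_le_mul_of_nonneg_right htn (abs_nonneg C)
    linarith
  have hα0 : 0 ≤ α := hlimit α (cross (I * u) v₂ / c₁₂) fun N => by
    obtain ⟨n, hNn, hn⟩ := hfreq N; exact ⟨n, hNn, (hcoordX n hn).1⟩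
  have hβ0 : 0 ≤ β := hlimit β (cross v₁ (I * u) / c₁₂) fun N => by
    obtain ⟨n, hNn, hn⟩ := hfreq N; exact ⟨n, hNn, (hcoordX n hn).2⟩
  -- (c) `u = α v₁ + β v₂`
  have hudec : u = (α : ℂ) * v₁ + (β : ℂ) * v₂ := by
    have hcr := cramer v₁ v₂ u
    have hc : (c₁₂ : ℂ) ≠ 0 := by exact_mod_cast hc₁₂0
    rw [hα, hβ]; push_cast
    field_simp
    rw [← hc₁₂] at hcr
    linear_combination hcr
  -- (d) both terms of `0 = u × u = α (u × v₁) + β (u × v₂)` vanish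
  have hsum0 : α * cross u v₁ + β * cross u v₂ = 0 := by
    have := congrArg (cross u) hudec
    rw [cross_self, cross_add_right, cross_ofReal_mul_right, cross_ofReal_mul_right] at this
    linarith
  have ht1 : α * (sB * cross u v₁) ≤ 0 := mul_nonpos_of_nonneg_of_nonpos hα0 (hfarv v₁ (Or.inl rfl))
  have ht2 : β * (sB * cross u v₂) ≤ 0 := mul_nonpos_of_nonneg_of_nonpos hβ0 (hfarv v₂ (Or.inr rfl))
  have hz1 : α * cross u v₁ = 0 := by
    have : α * (sB * cross u v₁) + β * (sB * cross u v₂) = 0 := by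
      have e1 : α * (sB * cross u v₁) + β * (sB * cross u v₂) = sB * (α * cross u v₁ + β * cross u v₂) := by
        ring
      rw [e1, hsum0, mul_zero]
    have h0 : α * (sB * cross u v₁) = 0 := by linarith
    rcases mul_eq_zero.1 h0 with h0 | h0
    · rw [h0, zero_mul]
    · rcases mul_eq_zero.1 h0 with h0 | h0
      · exact absurd h0 hsB0
      · rw [h0, mul_zero]
  have hz2 : β * cross u v₂ = 0 := by linarith
  -- (e) one of the side vectors is `u`
  have hside_u : v₁ = u ∨ v₂ = u := by
    rcases mul_eq_zero.1 hz1 with ha | ha <;> rcases mul_eq_zero.1 hz2 with hb | hb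
    · -- `α = 0`, `β = 0`: `u = 0`
      exfalso
      rw [ha, hb] at hudec; push_cast at hudec
      have : u = 0 := by rw [hudec]; ring
      rw [this, norm_zero] at hu; exact zero_ne_one hu
    · -- `α = 0`, `u × v₂ = 0`
      right
      rw [ha] at hudec; push_cast at hudec; rw [zero_mul, zero_add] at hudec
      have hn := congrArg norm hudec
      rw [hu, norm_mul, Complex.norm_real, hvn₂, mul_one, Real.norm_eq_abs, abs_of_nonneg hβ0] at hn
      rw [hudec, ← hn]; push_cast; ring
    · -- `u × v₁ = 0`, `β = 0`
      left
      rw [hb] at hudec; push_cast at hudec; rw [zero_mul, add_zero] at hudec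
      have hn := congrArg norm hudec
      rw [hu, norm_mul, Complex.norm_real, hvn₁, mul_one, Real.norm_eq_abs, abs_of_nonneg hα0] at hn
      rw [hudec, ← hn]; push_cast; ring
    · -- both parallel to `u`: degenerate
      exfalso
      apply hc₁₂0
      rcases dot_eq_one_or_neg_one hu hvn₁ ha with h1 | h1 <;>
        rcases dot_eq_one_or_neg_one hu hvn₂ hb with h2 | h2 <;>
        rw [hc₁₂, h1, h2] <;>
        simp [cross_neg_left, cross_neg_right]
  have hgsq : s(q, q + u) ∈ emb.tileSides e₁ := by
    rcases hside_u with h0 | h0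
    · have : N₁ = q + u := by rw [← h0, hv₁]; ring
      rw [← this]; exact hgs₁
    · have : N₂ = q + u := by rw [← h0, hv₂]; ring
      rw [← this]; exact hgs₂
  -- K. the sign
  exact ⟨e₁, hqcorner, hgsq, sign_flip_of_side_on_line hiso hu hsB hδ₀ hgsq hq0 hfar1⟩

end FaultStep

/-! ### §3 The fault line: march, cover, sides, and disconnection -/

section FaultLine

open RhombicPlanarity

variable {V F : Type*} {G : SimpleGraph V} {emb : RhombicEmbedding G F} {ε : ℝ}

/-- Points `q₀ + t u` are on the line `{h = 0}`. [folklore] -/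
theorem cross_line_point (u q₀ : ℂ) (t : ℝ) : cross u (q₀ + (t : ℂ) * u - q₀) = 0 := by
  rw [add_sub_cancel_left, cross_ofReal_mul_right, cross_self, mul_zero]

/-- **The march of the fault line.** From a T-junction at `q₀` (a corner of the rhombus of `eA`
lying in the open side `(x, x + u)` of the rhombus of `eB ⊆ {s_B h ≥ 0}`, `h X = u × (X - q₀)`):
for every `k`, some rhombus in `{s_B h ≤ 0}` has the side `{q₀ + k u, q₀ + (k+1) u}` and some
rhombus in `{s_B h ≥ 0}` has the side `{x + (k+1) u, x + (k+2) u}`. [folklore] -/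
theorem fault_march (hiso : emb.IsIsoradial) (hrh : emb.IsRhombicTiling)
    (hbap : emb.HasBoundedAngles ε) (hε : 0 < ε) (hnb : ∀ v : V, ∃ w, G.Adj v w) {q₀ u : ℂ}
    (hu : ‖u‖ = 1) {sB : ℝ} (hsB : sB = 1 ∨ sB = -1) {eB eA : G.edgeSet} {x : ℂ}
    (hKB : ∀ X ∈ emb.rhombus eB, 0 ≤ sB * cross u (X - q₀)) (hgs : s(x, x + u) ∈ emb.tileSides eB)
    (hq : q₀ ∈ openSegment ℝ x (x + u)) (hqA : q₀ ∈ emb.cornerSet eA) (k : ℕ) :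
    (∃ eU : G.edgeSet, s(q₀ + (k : ℂ) * u, q₀ + ((k : ℂ) + 1) * u) ∈ emb.tileSides eU ∧
        ∀ X ∈ emb.rhombus eU, 0 ≤ -sB * cross u (X - q₀)) ∧
      (∃ eL : G.edgeSet, s(x + ((k : ℂ) + 1) * u, x + ((k : ℂ) + 2) * u) ∈ emb.tileSides eL ∧
        ∀ X ∈ emb.rhombus eL, 0 ≤ sB * cross u (X - q₀)) := by
  obtain ⟨θ, hθ0, hθ1, hqθ⟩ := exists_coord_of_mem_openSegment hq
  simp only [add_sub_cancel_left] at hqθ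
  -- `x = q₀ - θ u`
  have hxq : x = q₀ + ((-θ : ℝ) : ℂ) * u := by rw [hqθ]; push_cast; ring
  have hsB' : -sB = 1 ∨ -sB = -1 := by rcases hsB with h | h <;> rw [h] <;> norm_num
  have hline : ∀ t : ℝ, cross u (q₀ + (t : ℂ) * u - q₀) = 0 := cross_line_point u q₀
  have hlinex : ∀ t : ℝ, cross u (x + (t : ℂ) * u - q₀) = 0 := by
    intro t
    have : x + (t : ℂ) * u = q₀ + ((-θ + t : ℝ) : ℂ) * u := by rw [hxq]; push_cast; ring
    rw [this]; exact hline _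
  -- one application of the step, in the two flavours needed
  have stepU : ∀ (m : ℕ) (eL eA' : G.edgeSet),
      (∀ X ∈ emb.rhombus eL, 0 ≤ sB * cross u (X - q₀)) →
      s(x + (m : ℂ) * u, x + ((m : ℂ) + 1) * u) ∈ emb.tileSides eL →
      q₀ + (m : ℂ) * u ∈ emb.cornerSet eA' →
      ∃ eU : G.edgeSet, s(q₀ + (m : ℂ) * u, q₀ + ((m : ℂ) + 1) * u) ∈ emb.tileSides eU ∧
        ∀ X ∈ emb.rhombus eU, 0 ≤ -sB * cross u (X - q₀) := by
    intro m eL eA' hKL hgsL hc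
    have hx' : cross u (x + (m : ℂ) * u - q₀) = 0 := by exact_mod_cast hlinex m
    have hgsL' : s(x + (m : ℂ) * u, x + (m : ℂ) * u + u) ∈ emb.tileSides eL := by
      have : x + ((m : ℂ) + 1) * u = x + (m : ℂ) * u + u := by ring
      rw [← this]; exact hgsL
    have hqo : q₀ + (m : ℂ) * u ∈ openSegment ℝ (x + (m : ℂ) * u) (x + (m : ℂ) * u + u) := by
      have := mem_openSegment_of_coord (x + (m : ℂ) * u) (x + (m : ℂ) * u + u) hθ0 hθ1
      have e1 : x + (m : ℂ) * u + (θ : ℂ) * (x + (m : ℂ) * u + u - (x + (m : ℂ) * u)) = q₀ + (m : ℂ) * u := by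
        rw [hqθ]; ring
      rwa [e1] at this
    obtain ⟨e₁, -, hgs₁, hK₁⟩ := exists_tile_continuing_fault hiso hrh hbap hε hnb hu hsB hKL hgsL'
      hx' hqo hc
    refine ⟨e₁, ?_, hK₁⟩
    have : q₀ + ((m : ℂ) + 1) * u = q₀ + (m : ℂ) * u + u := by ring
    rw [this]; exact hgs₁
  have stepL : ∀ (m : ℕ) (eU eA' : G.edgeSet),
      (∀ X ∈ emb.rhombus eU, 0 ≤ -sB * cross u (X - q₀)) →
      s(q₀ + (m : ℂ) * u, q₀ + ((m : ℂ) + 1) * u) ∈ emb.tileSides eU →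
      x + ((m : ℂ) + 1) * u ∈ emb.cornerSet eA' →
      ∃ eL : G.edgeSet, s(x + ((m : ℂ) + 1) * u, x + ((m : ℂ) + 2) * u) ∈ emb.tileSides eL ∧
        ∀ X ∈ emb.rhombus eL, 0 ≤ sB * cross u (X - q₀) := by
    intro m eU eA' hKU hgsU hc
    have hx' : cross u (q₀ + (m : ℂ) * u - q₀) = 0 := by exact_mod_cast hline m
    have hgsU' : s(q₀ + (m : ℂ) * u, q₀ + (m : ℂ) * u + u) ∈ emb.tileSides eU := by
      have : q₀ + ((m : ℂ) + 1) * u = q₀ + (m : ℂ) * u + u := by ring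
      rw [← this]; exact hgsU
    have hqo : x + ((m : ℂ) + 1) * u ∈ openSegment ℝ (q₀ + (m : ℂ) * u) (q₀ + (m : ℂ) * u + u) := by
      have := mem_openSegment_of_coord (q₀ + (m : ℂ) * u) (q₀ + (m : ℂ) * u + u) (θ := 1 - θ)
        (by linarith) (by linarith)
      have e1 : q₀ + (m : ℂ) * u + ((1 - θ : ℝ) : ℂ) * (q₀ + (m : ℂ) * u + u - (q₀ + (m : ℂ) * u)) =
          x + ((m : ℂ) + 1) * u := by
        rw [hxq]; push_cast; ring
      rwa [e1] at this
    obtain ⟨e₁, -, hgs₁, hK₁⟩ := exists_tile_continuing_fault hiso hrh hbap hε hnb hu hsB' hKU hgsU'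
      hx' hqo hc
    refine ⟨e₁, ?_, fun X hX => by have := hK₁ X hX; rwa [neg_neg] at this⟩
    have : x + ((m : ℂ) + 2) * u = x + ((m : ℂ) + 1) * u + u := by ring
    rw [this]; exact hgs₁
  induction k with
  | zero =>
    have hU := stepU 0 eB eA (by simpa using hKB) (by simpa using hgs) (by simpa using hqA)
    obtain ⟨eU, hgsU, hKU⟩ := hU
    refine ⟨⟨eU, hgsU, hKU⟩, ?_⟩
    have hc : x + ((0 : ℕ) : ℂ) * u + u ∈ emb.cornerSet eB := by
      simpa using (mem_cornerSet_of_mem_tileSides hiso hgs).2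
    have := stepL 0 eU eB hKU hgsU (by simpa using (mem_cornerSet_of_mem_tileSides hiso hgs).2)
    simpa using this
  | succ k ih =>
    obtain ⟨⟨eU, hgsU, hKU⟩, ⟨eL, hgsL, hKL⟩⟩ := ih
    -- the new upper tile at `q₀ + (k+1) u`, a corner of `eU`, in the open side of `eL`
    have hc1 : q₀ + ((k + 1 : ℕ) : ℂ) * u ∈ emb.cornerSet eU := by
      have := (mem_cornerSet_of_mem_tileSides hiso hgsU).2; push_cast; exact this
    have hgsL' : s(x + ((k + 1 : ℕ) : ℂ) * u, x + (((k + 1 : ℕ) : ℂ) + 1) * u) ∈ emb.tileSides eL := by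
      push_cast; have : (k : ℂ) + 1 + 1 = (k : ℂ) + 2 := by ring
      rw [this]; exact hgsL
    obtain ⟨eU', hgsU', hKU'⟩ := stepU (k + 1) eL eU hKL hgsL' hc1
    refine ⟨⟨eU', hgsU', hKU'⟩, ?_⟩
    -- the new lower tile at `x + (k+2) u`, a corner of `eL`, in the open side of `eU'`
    have hc2 : x + (((k + 1 : ℕ) : ℂ) + 1) * u ∈ emb.cornerSet eL := by
      have := (mem_cornerSet_of_mem_tileSides hiso hgsL).2; push_cast at this ⊢
      have e1 : (k : ℂ) + 1 + 1 = (k : ℂ) + 2 := by ring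
      rw [e1]; exact this
    exact stepL (k + 1) eU' eL hKU' hgsU' hc2

/-- No interior point of a rhombus lies on a side of a rhombus. [folklore] -/
theorem not_mem_segment_of_mem_tileSides_of_mem_interior (hiso : emb.IsIsoradial)
    (hrh : emb.IsRhombicTiling) {e e' : G.edgeSet} {a a' X : ℂ} (hσ : s(a, a') ∈ emb.tileSides e')
    (hXi : X ∈ interior (emb.rhombus e)) : X ∉ segment ℝ a a' := by
  obtain ⟨d, b, -, hsd⟩ := (mem_tileSides_iff hiso e' _).1 hσ
  rw [stdSide_mk] at hsd
  rw [← segment_eq_of_sym2_eq hsd]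
  exact not_mem_stdSide_of_mem_interior hiso hrh hXi d b

/-- **No corner sits on an open side of a rhombus on the same side of the line.** If the rhombi of
`e` and `eU` both lie in `{s h ≥ 0}`, `eU` has the side `{a, a + u}` on the line, and a corner
`r` of `e` lies in that open side, contradiction (the two rhombi would overlap near `r`).
[folklore] -/
theorem false_of_corner_mem_openSide (hiso : emb.IsIsoradial) (hrh : emb.IsRhombicTiling)
    {q₀ u : ℂ} (hu : ‖u‖ = 1) {s : ℝ} (hs : s = 1 ∨ s = -1) {e eU : G.edgeSet} {a r : ℂ}
    (hK : ∀ X ∈ emb.rhombus e, 0 ≤ s * cross u (X - q₀)) (hr : r ∈ emb.cornerSet e)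
    (hKU : ∀ X ∈ emb.rhombus eU, 0 ≤ s * cross u (X - q₀)) (hσ : s(a, a + u) ∈ emb.tileSides eU)
    (ha : cross u (a - q₀) = 0) (hro : r ∈ openSegment ℝ a (a + u)) : False := by
  obtain ⟨δ, hδ, hhalf⟩ := exists_halfDisc_of_side_on_line hiso hu hs hKU hσ ha hro
  obtain ⟨Z, hZb, hZi⟩ := exists_mem_interior_rhombus_of_isOpen hiso isOpen_ball (mem_ball_self hδ)
    (cornerSet_subset_rhombus hiso e hr)
  have hZU : Z ∈ emb.rhombus eU := hhalf Z (mem_ball.1 hZb) (hK Z (interior_subset hZi))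
  obtain ⟨Z', hZ'e, hZ'U⟩ := exists_mem_interior_rhombus_of_isOpen hiso isOpen_interior hZi hZU
  have heU : e = eU := by
    by_contra hne; exact Set.disjoint_left.1 (hrh.disjoint_interior hne) hZ'e hZ'U
  subst heU
  exact not_mem_openSegment_of_mem_cornerSet hiso hσ hr hro

/-- **A T-junction is impossible in a preconnected isoradial rhombic tiling.** The core of
`noTJunction_of_preconnected`, with the T-junction presented geometrically: the rhombus of
`eB` has the side `{x, x + u}`, and the point `q₀` of that open side is a corner of the rhombus
of `eA`. [cite: GrimmettManolescu2014Isoradial, §4.1 (the diamond graph is a rhombic tiling)] -/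
theorem false_of_tJunction (hiso : emb.IsIsoradial) (hrh : emb.IsRhombicTiling)
    (hbap : emb.HasBoundedAngles ε) (hε : 0 < ε) (hconn : G.Preconnected) {u : ℂ} (hu : ‖u‖ = 1)
    {eB eA : G.edgeSet} {x q₀ : ℂ} (hgs : s(x, x + u) ∈ emb.tileSides eB)
    (hq : q₀ ∈ openSegment ℝ x (x + u)) (hqA : q₀ ∈ emb.cornerSet eA) : False := by
  classical
  have hnb : ∀ v : V, ∃ w, G.Adj v w := fun v =>
    IsoradialCriticality.exists_adj_of_preconnected hconn (RhombicEmbedding.refDart eB).adj v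
  -- the line through the side, based at `q₀`; `h X = u × (X - q₀)`
  obtain ⟨θ, hθ0, hθ1, hqθ⟩ := exists_coord_of_mem_openSegment hq
  simp only [add_sub_cancel_left] at hqθ
  have hxq : x = q₀ + ((-θ : ℝ) : ℂ) * u := by rw [hqθ]; push_cast; ring
  have hx : cross u (x - q₀) = 0 := by rw [hxq]; exact cross_line_point u q₀ _
  -- the sign of `eB`
  obtain ⟨B', Q', hquadB, hKBeq, -⟩ := exists_isUnitQuad_of_mem_tileSides hiso hgs
  set σ : ℝ := cross u (Q' - x) with hσ
  have hσ0 : σ ≠ 0 := by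
    have := cross_ne_zero_of_quad hquadB.sum hquadB.ne_AB hquadB.ne_PQ hquadB.norm_AP hquadB.norm_BP
    simpa using this
  set sB : ℝ := if 0 < σ then 1 else -1 with hsBdef
  have hsB : sB = 1 ∨ sB = -1 := by rw [hsBdef]; split_ifs <;> simp
  have hsBσ : 0 < sB * σ := by
    rw [hsBdef]; split_ifs with h
    · linarith
    · have : σ < 0 := lt_of_le_of_ne (not_lt.1 h) hσ0
      linarith
  have hKB : ∀ X ∈ emb.rhombus eB, 0 ≤ sB * cross u (X - q₀) := by
    intro X hX
    rw [hKBeq] at hX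
    have h1 := cross_mul_cross_nonneg_of_mem hquadB.sum hX
    simp only [add_sub_cancel_left] at h1
    rw [← hσ] at h1
    have hrel : cross u (X - x) = cross u (X - q₀) := by
      have : X - x = (X - q₀) - (x - q₀) := by ring
      rw [this, cross_sub_right, hx, sub_zero]
    rw [hrel] at h1
    have := mul_nonneg h1 hsBσ.le
    have e1 : cross u (X - q₀) * σ * (sB * σ) = sB * cross u (X - q₀) * (σ * σ) := by ring
    rw [e1] at this
    exact nonneg_of_mul_nonneg_left this (mul_self_pos.2 hσ0)
  -- the march in both directions
  have hmarch := fault_march hiso hrh hbap hε hnb hu hsB hKB hgs hq hqA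
  have hun : ‖-u‖ = 1 := by rw [norm_neg, hu]
  have hsB' : -sB = 1 ∨ -sB = -1 := by rcases hsB with h | h <;> rw [h] <;> norm_num
  have hKB' : ∀ X ∈ emb.rhombus eB, 0 ≤ -sB * cross (-u) (X - q₀) := by
    intro X hX; rw [cross_neg_left]; have := hKB X hX; linarith
  have hgs' : s(x + u, x + u + -u) ∈ emb.tileSides eB := by
    rw [show x + u + -u = x by ring, Sym2.eq_swap]; exact hgs
  have hq' : q₀ ∈ openSegment ℝ (x + u) (x + u + -u) := by
    rw [show x + u + -u = x by ring, openSegment_symm]; exact hq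
  have hmarch' := fault_march hiso hrh hbap hε hnb hun hsB' hKB' hgs' hq' hqA
  -- Upper / Lower
  set Up : G.edgeSet → Prop := fun e => ∀ X ∈ emb.rhombus e, 0 ≤ -sB * cross u (X - q₀) with hUp
  set Lo : G.edgeSet → Prop := fun e => ∀ X ∈ emb.rhombus e, 0 ≤ sB * cross u (X - q₀) with hLo
  -- integer-indexed covers of the line by upper sides `[q₀ + m u, q₀ + (m+1) u]`
  -- and lower sides `[x + m u, x + (m+1) u]`
  have hcovU : ∀ m : ℤ, ∃ e, Up e ∧ s(q₀ + (m : ℂ) * u, q₀ + ((m : ℂ) + 1) * u) ∈ emb.tileSides e := by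
    intro m
    rcases le_or_gt 0 m with hm | hm
    · obtain ⟨k, rfl⟩ := Int.eq_ofNat_of_zero_le hm
      obtain ⟨⟨eU, hgsU, hKU⟩, -⟩ := hmarch k
      exact ⟨eU, hKU, by exact_mod_cast hgsU⟩
    · -- `m = -(k+1)`: the `k`-th upper tile of the backward march
      obtain ⟨k, hk⟩ := Int.exists_eq_neg_ofNat (by linarith : m ≤ 0)
      obtain ⟨k', rfl⟩ : ∃ k' : ℕ, k = k' + 1 := by
        rcases k with _ | k'
        · simp at hk; linarith
        · exact ⟨k', rfl⟩
      obtain ⟨⟨eU, hgsU, hKU⟩, -⟩ := hmarch' k'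
      refine ⟨eU, fun X hX => by have := hKU X hX; rw [cross_neg_left] at this; linarith, ?_⟩
      rw [hk]; push_cast
      have e1 : q₀ + -((k' : ℂ) + 1) * u = q₀ + ((k' : ℂ) + 1) * -u := by ring
      have e2 : q₀ + (-((k' : ℂ) + 1) + 1) * u = q₀ + (k' : ℂ) * -u := by ring
      rw [e1, e2, Sym2.eq_swap]; exact hgsU
  have hcovL : ∀ m : ℤ, ∃ e, Lo e ∧ s(x + (m : ℂ) * u, x + ((m : ℂ) + 1) * u) ∈ emb.tileSides e := by
    intro m
    rcases lt_trichotomy m 0 with hm | rfl | hm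
    · obtain ⟨k, hk⟩ := Int.exists_eq_neg_ofNat hm.le
      obtain ⟨k', rfl⟩ : ∃ k' : ℕ, k = k' + 1 := by
        rcases k with _ | k'
        · simp at hk; linarith
        · exact ⟨k', rfl⟩
      obtain ⟨-, ⟨eL, hgsL, hKL⟩⟩ := hmarch' k'
      refine ⟨eL, fun X hX => by have := hKL X hX; rw [cross_neg_left] at this; linarith, ?_⟩
      rw [hk]; push_cast
      have e1 : x + -((k' : ℂ) + 1) * u = x + u + ((k' : ℂ) + 2) * -u := by ring
      have e2 : x + (-((k' : ℂ) + 1) + 1) * u = x + u + ((k' : ℂ) + 1) * -u := by ring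
      rw [e1, e2, Sym2.eq_swap]; exact hgsL
    · exact ⟨eB, hKB, by simpa using hgs⟩
    · obtain ⟨k, hk⟩ := Int.eq_ofNat_of_zero_le hm.le
      obtain ⟨k', rfl⟩ : ∃ k' : ℕ, k = k' + 1 := by
        rcases k with _ | k'
        · simp at hk; linarith
        · exact ⟨k', rfl⟩
      obtain ⟨-, ⟨eL, hgsL, hKL⟩⟩ := hmarch k'
      refine ⟨eL, hKL, ?_⟩
      rw [hk]; push_cast
      have e2 : x + ((k' : ℂ) + 1 + 1) * u = x + ((k' : ℂ) + 2) * u := by ring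
      rw [e2]; exact hgsL
  -- every point of the line lies on an upper side and on a lower side, one of them open
  have honline : ∀ X : ℂ, cross u (X - q₀) = 0 → ∃ t : ℝ, X = q₀ + (t : ℂ) * u := by
    intro X hX
    refine ⟨dot u (X - q₀), ?_⟩
    have := eq_dot_mul_of_cross_eq_zero hu hX
    linear_combination this
  have hmemU : ∀ t : ℝ, q₀ + (t : ℂ) * u ∈
      segment ℝ (q₀ + ((⌊t⌋ : ℤ) : ℂ) * u) (q₀ + (((⌊t⌋ : ℤ) : ℂ) + 1) * u) := by
    intro t
    refine ⟨1 - Int.fract t, Int.fract t, by linarith [Int.fract_lt_one t], Int.fract_nonneg t,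
      by ring, ?_⟩
    simp only [Complex.real_smul]
    have : (t : ℂ) = ((⌊t⌋ : ℤ) : ℂ) + ((Int.fract t : ℝ) : ℂ) := by
      have := (Int.floor_add_fract t).symm
      exact_mod_cast congrArg (fun r : ℝ => (r : ℂ)) this
    rw [this]; push_cast; ring
  have hmemUo : ∀ t : ℝ, Int.fract t ≠ 0 → q₀ + (t : ℂ) * u ∈
      openSegment ℝ (q₀ + ((⌊t⌋ : ℤ) : ℂ) * u) (q₀ + (((⌊t⌋ : ℤ) : ℂ) + 1) * u) := by
    intro t ht
    have h0 : 0 < Int.fract t := lt_of_le_of_ne (Int.fract_nonneg t) (Ne.symm ht)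
    have := mem_openSegment_of_coord (q₀ + ((⌊t⌋ : ℤ) : ℂ) * u) (q₀ + (((⌊t⌋ : ℤ) : ℂ) + 1) * u)
      h0 (Int.fract_lt_one t)
    have e1 : q₀ + ((⌊t⌋ : ℤ) : ℂ) * u + ((Int.fract t : ℝ) : ℂ) *
        (q₀ + (((⌊t⌋ : ℤ) : ℂ) + 1) * u - (q₀ + ((⌊t⌋ : ℤ) : ℂ) * u)) = q₀ + (t : ℂ) * u := by
      have : (t : ℂ) = ((⌊t⌋ : ℤ) : ℂ) + ((Int.fract t : ℝ) : ℂ) := by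
        have := (Int.floor_add_fract t).symm
        exact_mod_cast congrArg (fun r : ℝ => (r : ℂ)) this
      rw [this]; ring
    rwa [e1] at this
  -- the same for the lower sides, via `x = q₀ - θ u`: `q₀ + t u = x + (t + θ) u`
  have hshift : ∀ t : ℝ, q₀ + (t : ℂ) * u = x + ((t + θ : ℝ) : ℂ) * u := by
    intro t; rw [hxq]; push_cast; ring
  have hmemL : ∀ t : ℝ, q₀ + (t : ℂ) * u ∈
      segment ℝ (x + ((⌊t + θ⌋ : ℤ) : ℂ) * u) (x + (((⌊t + θ⌋ : ℤ) : ℂ) + 1) * u) := by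
    intro t
    rw [hshift]
    refine ⟨1 - Int.fract (t + θ), Int.fract (t + θ), by linarith [Int.fract_lt_one (t + θ)],
      Int.fract_nonneg _, by ring, ?_⟩
    simp only [Complex.real_smul]
    have : ((t + θ : ℝ) : ℂ) = ((⌊t + θ⌋ : ℤ) : ℂ) + ((Int.fract (t + θ) : ℝ) : ℂ) := by
      have := (Int.floor_add_fract (t + θ)).symm
      exact_mod_cast congrArg (fun r : ℝ => (r : ℂ)) this
    rw [this]; push_cast; ring
  have hmemLo : ∀ t : ℝ, Int.fract (t + θ) ≠ 0 → q₀ + (t : ℂ) * u ∈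
      openSegment ℝ (x + ((⌊t + θ⌋ : ℤ) : ℂ) * u) (x + (((⌊t + θ⌋ : ℤ) : ℂ) + 1) * u) := by
    intro t ht
    rw [hshift]
    have h0 : 0 < Int.fract (t + θ) := lt_of_le_of_ne (Int.fract_nonneg _) (Ne.symm ht)
    have := mem_openSegment_of_coord (x + ((⌊t + θ⌋ : ℤ) : ℂ) * u)
      (x + (((⌊t + θ⌋ : ℤ) : ℂ) + 1) * u) h0 (Int.fract_lt_one (t + θ))
    have e1 : x + ((⌊t + θ⌋ : ℤ) : ℂ) * u + ((Int.fract (t + θ) : ℝ) : ℂ) *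
        (x + (((⌊t + θ⌋ : ℤ) : ℂ) + 1) * u - (x + ((⌊t + θ⌋ : ℤ) : ℂ) * u)) =
        x + ((t + θ : ℝ) : ℂ) * u := by
      have : ((t + θ : ℝ) : ℂ) = ((⌊t + θ⌋ : ℤ) : ℂ) + ((Int.fract (t + θ) : ℝ) : ℂ) := by
        have := (Int.floor_add_fract (t + θ)).symm
        exact_mod_cast congrArg (fun r : ℝ => (r : ℂ)) this
      rw [this]; ring
    rwa [e1] at this
  have hfract : ∀ t : ℝ, Int.fract t = 0 → Int.fract (t + θ) ≠ 0 := by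
    intro t ht hθ'
    rw [Int.fract_eq_iff] at ht hθ'
    obtain ⟨-, -, m, hm⟩ := ht
    obtain ⟨-, -, m', hm'⟩ := hθ'
    have : (θ : ℝ) = m' - m := by linarith
    have h1 : (0 : ℝ) < m' - m := by linarith
    have h2 : (m' - m : ℝ) < 1 := by linarith
    have h3 : (0 : ℤ) < m' - m := by exact_mod_cast h1
    have h4 : (m' - m : ℤ) < 1 := by exact_mod_cast h2
    omega
  -- F1: no interior point of a rhombus lies on the line
  have hF1 : ∀ (e : G.edgeSet) (X : ℂ), X ∈ interior (emb.rhombus e) → cross u (X - q₀) ≠ 0 := by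
    intro e X hXi hX0
    obtain ⟨t, rfl⟩ := honline X hX0
    obtain ⟨eU, -, hgsU⟩ := hcovU ⌊t⌋
    exact not_mem_segment_of_mem_tileSides_of_mem_interior hiso hrh hgsU hXi (hmemU t)
  -- every rhombus is Upper or Lower
  have hUL : ∀ e : G.edgeSet, Up e ∨ Lo e := by
    intro e
    by_contra hcon
    rw [not_or] at hcon
    obtain ⟨hnU, hnL⟩ := hcon
    simp only [hUp, hLo, not_forall, not_le, exists_prop] at hnU hnL
    obtain ⟨X, hX, hXs⟩ := hnU
    obtain ⟨Y, hY, hYs⟩ := hnL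
    -- interior points with the same strict signs
    set f : ℂ → ℝ := fun Z => sB * cross u (Z - q₀) with hf
    have hfc : Continuous f := continuous_const.mul (continuous_cross_right u q₀)
    have hXc := rhombus_subset_closure_interior hiso e hX
    have hYc := rhombus_subset_closure_interior hiso e hY
    obtain ⟨X', hX'U, hX'i⟩ := (_root_.mem_closure_iff.1 hXc) {Z | 0 < f Z}
      (isOpen_lt continuous_const hfc) (by simp only [mem_setOf_eq, hf]; linarith)
    obtain ⟨Y', hY'U, hY'i⟩ := (_root_.mem_closure_iff.1 hYc) {Z | f Z < 0}
      (isOpen_lt hfc continuous_const) (by simp only [mem_setOf_eq, hf]; linarith)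
    simp only [mem_setOf_eq] at hX'U hY'U
    have hpre : IsPreconnected (interior (emb.rhombus e)) :=
      ((convex_rhombus e).interior).isPreconnected
    have := hpre.intermediate_value hY'i hX'i hfc.continuousOn ⟨hY'U.le, hX'U.le⟩
    obtain ⟨Z, hZi, hZ0⟩ := this
    apply hF1 e Z hZi
    rcases mul_eq_zero.1 hZ0 with h0 | h0
    · rcases hsB with h1 | h1 <;> rw [h1] at h0 <;> norm_num at h0
    · exact h0
  -- F2: no point is a corner of an upper and of a lower rhombus
  have hF2 : ∀ (r : ℂ) (e e' : G.edgeSet), Up e → Lo e' → r ∈ emb.cornerSet e →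
      r ∈ emb.cornerSet e' → False := by
    intro r e e' hUe hLe' hre hre'
    have hr0 : cross u (r - q₀) = 0 := by
      have h1 := hUe r (cornerSet_subset_rhombus hiso e hre)
      have h2 := hLe' r (cornerSet_subset_rhombus hiso e' hre')
      have : sB * cross u (r - q₀) = 0 := by linarith
      rcases mul_eq_zero.1 this with h0 | h0
      · rcases hsB with h1 | h1 <;> rw [h1] at h0 <;> norm_num at h0
      · exact h0
    obtain ⟨t, rfl⟩ := honline r hr0
    by_cases ht : Int.fract t = 0
    · -- on an open lower side
      obtain ⟨eL, hLL, hgsL⟩ := hcovL ⌊t + θ⌋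
      have hgsL' : s(x + ((⌊t + θ⌋ : ℤ) : ℂ) * u, x + ((⌊t + θ⌋ : ℤ) : ℂ) * u + u) ∈ emb.tileSides eL := by
        have : x + (((⌊t + θ⌋ : ℤ) : ℂ) + 1) * u = x + ((⌊t + θ⌋ : ℤ) : ℂ) * u + u := by ring
        rw [← this]; exact hgsL
      have hro := hmemLo t (hfract t ht)
      rw [show x + (((⌊t + θ⌋ : ℤ) : ℂ) + 1) * u = x + ((⌊t + θ⌋ : ℤ) : ℂ) * u + u by ring] at hro
      have hx0 : cross u (x + ((⌊t + θ⌋ : ℤ) : ℂ) * u - q₀) = 0 := by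
        have : x + ((⌊t + θ⌋ : ℤ) : ℂ) * u = q₀ + ((-θ + (⌊t + θ⌋ : ℤ) : ℝ) : ℂ) * u := by
          rw [hxq]; push_cast; ring
        rw [this]; exact cross_line_point u q₀ _
      exact false_of_corner_mem_openSide hiso hrh hu hsB hLe' hre' hLL hgsL' hx0 hro
    · -- on an open upper side
      obtain ⟨eU, hUU, hgsU⟩ := hcovU ⌊t⌋
      have hgsU' : s(q₀ + ((⌊t⌋ : ℤ) : ℂ) * u, q₀ + ((⌊t⌋ : ℤ) : ℂ) * u + u) ∈ emb.tileSides eU := by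
        have : q₀ + (((⌊t⌋ : ℤ) : ℂ) + 1) * u = q₀ + ((⌊t⌋ : ℤ) : ℂ) * u + u := by ring
        rw [← this]; exact hgsU
      have hro := hmemUo t ht
      rw [show q₀ + (((⌊t⌋ : ℤ) : ℂ) + 1) * u = q₀ + ((⌊t⌋ : ℤ) : ℂ) * u + u by ring] at hro
      have hx0 : cross u (q₀ + ((⌊t⌋ : ℤ) : ℂ) * u - q₀) = 0 := by
        exact_mod_cast cross_line_point u q₀ (⌊t⌋ : ℤ)
      exact false_of_corner_mem_openSide hiso hrh hu hsB' hUe hre hUU hgsU' hx0 hro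
  -- vertex sides: the rhombi at one vertex are all upper or all lower
  have hvert : ∀ d d' : G.Dart, d.fst = d'.fst → Up ⟨d.edge, d.edge_mem⟩ → Up ⟨d'.edge, d'.edge_mem⟩ := by
    intro d d' hdd hUd
    have hc : emb.z d.fst ∈ emb.cornerSet ⟨d.edge, d.edge_mem⟩ := by
      rw [cornerSet_dart hiso d]; simp
    have hc' : emb.z d.fst ∈ emb.cornerSet ⟨d'.edge, d'.edge_mem⟩ := by
      rw [hdd, cornerSet_dart hiso d']; simp
    rcases hUL ⟨d'.edge, d'.edge_mem⟩ with h | h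
    · exact h
    · exact absurd (hF2 _ _ _ hUd h hc hc') id
  -- propagate along walks
  have hwalk : ∀ {v w : V} (W : G.Walk v w), (∃ d : G.Dart, d.fst = v ∧ Up ⟨d.edge, d.edge_mem⟩) →
      ∃ d : G.Dart, d.fst = w ∧ Up ⟨d.edge, d.edge_mem⟩ := by
    intro v w W
    induction W with
    | nil => exact id
    | cons hadj W ih =>
      rename_i a b c
      intro ⟨d, hd, hUd⟩
      apply ih
      set d₁ : G.Dart := ⟨(a, b), hadj⟩ with hd₁
      have hU₁ : Up ⟨d₁.edge, d₁.edge_mem⟩ := hvert d d₁ (by rw [hd]) hUd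
      refine ⟨d₁.symm, rfl, ?_⟩
      rw [show (⟨d₁.symm.edge, d₁.symm.edge_mem⟩ : G.edgeSet) = ⟨d₁.edge, d₁.edge_mem⟩ from
        Subtype.ext d₁.edge_symm]
      exact hU₁
  -- an upper tile exists (the first upper tile of the march) and `eB` is lower
  obtain ⟨⟨eU, -, hKU⟩, -⟩ := hmarch 0
  set dU := RhombicEmbedding.refDart eU with hdU
  set dB := RhombicEmbedding.refDart eB with hdB
  obtain ⟨W⟩ := hconn dU.fst dB.fst
  obtain ⟨d, hd, hUd⟩ := hwalk W ⟨dU, rfl, by rw [edge_refDart]; exact hKU⟩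
  have hUB : Up ⟨dB.edge, dB.edge_mem⟩ := hvert d dB hd hUd
  rw [edge_refDart] at hUB
  -- `eB` is both upper and lower: its centre is on the line
  have hc := tileCentre_mem_interior hiso eB
  apply hF1 eB _ hc
  have h1 := hUB _ (interior_subset hc)
  have h2 := hKB _ (interior_subset hc)
  have : sB * cross u (emb.tileCentre eB - q₀) = 0 := by linarith
  rcases mul_eq_zero.1 this with h0 | h0
  · rcases hsB with h1 | h1 <;> rw [h1] at h0 <;> norm_num at h0
  · exact h0

/-- **No T-junctions in a preconnected isoradial rhombic tiling.** Under `IsIsoradial`,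
`IsRhombicTiling`, `HasBoundedAngles ε` (`0 < ε`) and `G.Preconnected`, no corner of a rhombus
lies in the open side of a rhombus: a T-junction would propagate along its line to a complete
*fault line* tiled from both sides by full sides with incommensurable breakpoints, across which
no vertex is shared, disconnecting `G` (Grimmett–Manolescu 2014, §4.1: the tiles of the diamond
graph of a connected isoradial graph meet full side to full side).
[cite: GrimmettManolescu2014Isoradial, §4.1 (the diamond graph is a rhombic tiling)] -/
theorem noTJunction_of_preconnected (hiso : emb.IsIsoradial) (hrh : emb.IsRhombicTiling)
    (hbap : emb.HasBoundedAngles ε) (hε : 0 < ε) (hconn : G.Preconnected) : emb.NoTJunction := by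
  intro d d' b q hq hqo
  obtain ⟨-, -, -, hAP, -⟩ := dart_quad' hiso d b
  set x := emb.z d.fst with hx
  set u : ℂ := emb.c (emb.dartFace d b) - emb.z d.fst with hu
  have hun : ‖u‖ = 1 := by rw [hu, norm_sub_rev, hAP]
  have hgs : s(x, x + u) ∈ emb.tileSides ⟨d.edge, d.edge_mem⟩ := by
    have : x + u = emb.c (emb.dartFace d b) := by rw [hu, hx]; ring
    rw [this]; exact stdSide_mem_tileSides hiso d b
  have hqA : q ∈ emb.cornerSet ⟨d'.edge, d'.edge_mem⟩ := by rw [cornerSet_dart hiso d']; exact hq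
  have hqo' : q ∈ openSegment ℝ x (x + u) := by
    have : x + u = emb.c (emb.dartFace d b) := by rw [hu, hx]; ring
    rw [this]; exact hqo
  exact false_of_tJunction hiso hrh hbap hε hconn hun hgs hqo' hqA

/-- **Corner consistency** of a preconnected isoradial rhombic tiling with bounded angles: no
vertex of `G` is drawn at a face centre (the hypothesis `hcons` of
`IsoradialDuality.gm_theta_critical_eq_zero_of_dual_boxCrossing`). Grimmett–Manolescu 2014, §4.1:
`G` and `G*` are the two colour classes of the bipartite rhombic tiling `G^◇`.
[cite: GrimmettManolescu2014Isoradial, §4.1 (G and G* read off the bipartite diamond graph)] -/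
theorem z_ne_c (hiso : emb.IsIsoradial) (hrh : emb.IsRhombicTiling) (hbap : emb.HasBoundedAngles ε)
    (hε : 0 < ε) (hconn : G.Preconnected) (v : V) (d : G.Dart) :
    emb.z v ≠ emb.c (emb.leftFace d) :=
  z_ne_c_of_noTJunction hiso hrh hbap hε (noTJunction_of_preconnected hiso hrh hbap hε hconn) hconn v d

end FaultLine

/-! ### §4 Application: `θ(P_G) = 0` from the box-crossing property of the dual, without `hcons` -/

section Dual

open LatticeModels

/-- **The box-crossing property of the dual measure implies `θ(P_G) = 0` on isoradial graphs**,
with the corner-consistency hypothesis `hcons` of `gm_theta_critical_eq_zero_of_dual_boxCrossing`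
(file `IsoradialDualCrossings`) discharged by `z_ne_c`: for a countable preconnected graph `G`,
isoradially and rhombically embedded with BAP(ε) (`0 < ε`), if for every aspect ratio `ρ > 0`
the dual-open crossings of `ρ n × n` rectangles (horizontally) and of `n × ρ n` rectangles
(vertically) have `P_G`-probability at least some `c(ρ) > 0` for all translations and all large
`n` — the box-crossing property of `P_{G*}` read on the primal configuration through
`ω*(e*) = 1 - ω(e)` (Grimmett–Manolescu 2014, §2.2 (2.4)) —, then `P_G(|C(x)| = ∞) = 0` for
every vertex `x`. This is Theorem 4 (b) of the paper in the form of its printed proof ("both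
`P_G` and `P_{G*}` have the box-crossing property; the claims then follow as in [GM1]"), modulo
the box-crossing property of the dual itself (`gm_boxCrossing` for `G*`).
[cite: GrimmettManolescu2014Isoradial, §3 Theorem 4 (Criticality) (b) and its proof via (2.4)–(2.5) (arXiv:1204.0505v2)] -/
theorem gm_theta_critical_eq_zero_of_dual_boxCrossing' {V F : Type*} [Countable V]
    {G : SimpleGraph V} (emb : RhombicEmbedding G F) {ε : ℝ} (hconn : G.Preconnected)
    (hiso : emb.IsIsoradial) (hrh : emb.IsRhombicTiling) (hε : 0 < ε)
    (hbap : emb.HasBoundedAngles ε)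
    (hdual : ∀ ρ : ℝ, 0 < ρ → ∃ c > (0 : ℝ), ∃ n₀ : ℕ, ∀ n : ℕ, n₀ ≤ n → ∀ w : ℂ,
      c ≤ emb.isoradialPercolation.real
          (emb.embDualRectCrossing (fun f => emb.c f - w) (ρ * n) n) ∧
        c ≤ emb.isoradialPercolation.real
          (emb.embDualTBCrossing (fun f => emb.c f - w) n (ρ * n)))
    (x : V) : emb.isoradialPercolation (percolatesAt x) = 0 :=
  gm_theta_critical_eq_zero_of_dual_boxCrossing emb hconn hiso hrh hε hbap
    (fun v d => z_ne_c hiso hrh hbap hε hconn v d) hdual x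

/-- **A primal open left–right crossing blocks every dual-open top–bottom crossing across it**
— the exclusion theorem `IsoradialDuality.not_mem_embDualTBCrossing_of_mem_embRectCrossing`
with its corner-consistency hypothesis discharged by `z_ne_c` (preconnected graph, bounded
angles). (Grimmett–Manolescu 2014, §2.2–2.3, planar duality for `G, G*`.)
[cite: GrimmettManolescu2014Isoradial, §2.2 (duality of G and G*)] -/
theorem not_mem_embDualTBCrossing_of_mem_embRectCrossing' {V F : Type*} {G : SimpleGraph V}
    (emb : RhombicEmbedding G F) {ε : ℝ} (hconn : G.Preconnected) (hiso : emb.IsIsoradial)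
    (hrh : emb.IsRhombicTiling) (hbap : emb.HasBoundedAngles ε) (hε : 0 < ε)
    {ω : BondConfig V} (hω : ω ⊆ G.edgeSet) {w : ℂ} {A B a₁ b₁ a' b' : ℝ}
    (ha₁ : 0 ≤ a₁) (ha' : 0 < a') (hA : a₁ + a' ≤ A) (hb₁ : b₁ ≤ 0) (hB : B ≤ b₁ + b')
    (hB0 : 0 < B) (hprim : ω ∈ embRectCrossing (fun v => emb.z v - w) A B) :
    ω ∉ emb.embDualTBCrossing (fun f => emb.c f - (w + ⟨a₁, b₁⟩)) a' b' :=
  IsoradialDuality.not_mem_embDualTBCrossing_of_mem_embRectCrossing emb hiso hrh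
    (fun v d => z_ne_c hiso hrh hbap hε hconn v d) hω ha₁ ha' hA hb₁ hB hB0 hprim

/-- **A primal open top–bottom crossing blocks every dual-open left–right crossing across it**
(`IsoradialDuality.not_mem_embDualRectCrossing_of_mem_embTBCrossing` without `hcons`).
[cite: GrimmettManolescu2014Isoradial, §2.2 (duality of G and G*)] -/
theorem not_mem_embDualRectCrossing_of_mem_embTBCrossing' {V F : Type*} {G : SimpleGraph V}
    (emb : RhombicEmbedding G F) {ε : ℝ} (hconn : G.Preconnected) (hiso : emb.IsIsoradial)
    (hrh : emb.IsRhombicTiling) (hbap : emb.HasBoundedAngles ε) (hε : 0 < ε)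
    {ω : BondConfig V} (hω : ω ⊆ G.edgeSet) {w : ℂ} {A B a₁ b₁ a' b' : ℝ}
    (ha₁ : 0 ≤ a₁) (ha' : 0 < a') (hB : a₁ + a' ≤ B) (hb₁ : b₁ ≤ 0) (hA : A ≤ b₁ + b')
    (hA0 : 0 < A) (hprim : ω ∈ embTBCrossing (fun v => emb.z v - w) A B) :
    ω ∉ emb.embDualRectCrossing (fun f => emb.c f - (w + ⟨b₁, a₁⟩)) b' a' :=
  IsoradialDuality.not_mem_embDualRectCrossing_of_mem_embTBCrossing emb hiso hrh
    (fun v d => z_ne_c hiso hrh hbap hε hconn v d) hω ha₁ ha' hB hb₁ hA hA0 hprim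

end Dual

/-! ### §5 Application: every side of the diamond graph lies in exactly two rhombi -/

section Sides

open LatticeModels RhombicEmbedding

variable {V F : Type*} {G : SimpleGraph V} {emb : RhombicEmbedding G F} {ε : ℝ}

/-- A combinatorial side `(v, f)` of the rhombus of `e` is a standard side of a dart over `e`.
[folklore] -/
theorem exists_dart_of_mem_sides [DecidableEq V] [DecidableEq F] (hiso : emb.IsIsoradial)
    {e : G.edgeSet} {p : V × F} (hp : p ∈ emb.sides e) :
    ∃ (d : G.Dart) (b : Bool), d.edge = e ∧ d.fst = p.1 ∧ emb.dartFace d b = p.2 := by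
  set d := RhombicEmbedding.refDart e with hd
  have he : d.edge = e := RhombicEmbedding.refDart_edge e
  rw [emb.sides_eq_dartSides hiso he] at hp
  simp only [dartSides, Finset.mem_insert, Finset.mem_singleton] at hp
  have h2 : emb.rightFace d.symm = emb.leftFace d := by
    have := hiso.leftFace_symm d.symm; rw [SimpleGraph.Dart.symm_symm] at this; exact this.symm
  rcases hp with rfl | rfl | rfl | rfl
  · exact ⟨d, true, he, rfl, rfl⟩
  · exact ⟨d.symm, false, d.edge_symm.trans he, rfl, by simp [h2]⟩
  · exact ⟨d.symm, true, d.edge_symm.trans he, rfl, by simp [hiso.leftFace_symm d]⟩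
  · exact ⟨d, false, he, rfl, rfl⟩

/-- A standard side of a dart is a combinatorial side of its edge. [folklore] -/
theorem mem_sides_of_dart [DecidableEq V] [DecidableEq F] (hiso : emb.IsIsoradial) (d : G.Dart)
    (b : Bool) : (d.fst, emb.dartFace d b) ∈ emb.sides ⟨d.edge, d.edge_mem⟩ := by
  rw [emb.sides_eq_dartSides hiso (d := d) rfl]
  cases b <;> simp [dartSides]

/-- **Every side of the diamond graph `G^◇` lies in exactly two rhombi.** In a preconnected
isoradial rhombic tiling with bounded angles, a combinatorial side `(v, f)` (vertex, face) of
the rhombus of an edge `e` is a side of exactly one other rhombus — the basic fact behind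
de Bruijn's train tracks (Grimmett–Manolescu 2014, §4.2: a track is continued across each
rhombus through the opposite side into *the* next rhombus; "each rhombus belongs to exactly
two tracks"). Existence: the tile across the geometric side (`exists_dart_across`, no
T-junctions by `noTJunction_of_preconnected`) is labelled consistently by corner consistency
(`z_ne_c`) and the injectivity of `z` and `c`; uniqueness: only two rhombi contain the
midpoint of the side. [cite: GrimmettManolescu2014Isoradial, §4.1–4.2 (rhombic tiling; train tracks)] -/
theorem existsUnique_other_edge_of_mem_sides [DecidableEq V] [DecidableEq F]
    (hiso : emb.IsIsoradial) (hrh : emb.IsRhombicTiling) (hbap : emb.HasBoundedAngles ε)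
    (hε : 0 < ε) (hconn : G.Preconnected) {e : G.edgeSet} {p : V × F} (hp : p ∈ emb.sides e) :
    ∃ e' : G.edgeSet, e' ≠ e ∧ p ∈ emb.sides e' ∧
      ∀ e'' : G.edgeSet, e'' ≠ e → p ∈ emb.sides e'' → e'' = e' := by
  have hnb : ∀ v : V, ∃ w, G.Adj v w := fun v =>
    IsoradialCriticality.exists_adj_of_preconnected hconn (RhombicEmbedding.refDart e).adj v
  have hT := noTJunction_of_preconnected hiso hrh hbap hε hconn
  obtain ⟨d, b, hde, hdv, hdf⟩ := exists_dart_of_mem_sides hiso hp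
  -- the tile across the midpoint of the side
  set A := emb.z d.fst with hA
  set P := emb.c (emb.dartFace d b) with hP
  have hmid : (A + P) / 2 ∈ openSegment ℝ A P := midpoint_mem_openSegment A P
  obtain ⟨d', b', hne, -, hends, hfar⟩ := exists_dart_across hiso hrh hbap hε hnb hT d b hmid
  -- consistent labelling
  have hlab : emb.z d'.fst = A ∧ emb.c (emb.dartFace d' b') = P := by
    rcases hends with h | ⟨h1, -⟩
    · exact h
    · exfalso
      -- a vertex at a face-centre position
      change emb.z d'.fst = emb.c (emb.dartFace d b) at h1
      cases b
      · rw [dartFace_false, ← hiso.leftFace_symm d] at h1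
        exact z_ne_c hiso hrh hbap hε hconn d'.fst d.symm h1
      · rw [dartFace_true] at h1
        exact z_ne_c hiso hrh hbap hε hconn d'.fst d h1
  have hv : d'.fst = p.1 := by rw [← hdv]; exact hiso.z_injective hlab.1
  have hf : emb.dartFace d' b' = p.2 := by rw [← hdf]; exact hrh.c_injective hlab.2
  refine ⟨⟨d'.edge, d'.edge_mem⟩, fun h => hne ((congrArg Subtype.val h).trans hde.symm), ?_, ?_⟩
  · have := mem_sides_of_dart hiso d' b'
    rwa [hv, hf] at this
  · -- uniqueness: a third rhombus with this side contains the midpoint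
    intro e'' hne'' hp''
    obtain ⟨d'', b'', hde'', hdv'', hdf'' ⟩ := exists_dart_of_mem_sides hiso hp''
    have he'' : e'' = ⟨d''.edge, d''.edge_mem⟩ := Subtype.ext hde''.symm
    have hseg : (A + P) / 2 ∈ emb.rhombus e'' := by
      rw [he'']
      refine segment_subset_rhombus hiso d'' b'' (openSegment_subset_segment ℝ _ _ ?_)
      have e1 : emb.z d''.fst = A := by rw [hA, hdv''.trans hdv.symm]
      have e2 : emb.c (emb.dartFace d'' b'') = P := by rw [hP, hdf'', hdf]
      rw [e1, e2]; exact hmid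
    obtain ⟨δ, hδ, hcov⟩ := ball_subset_union_of_across hiso d b hmid d' b' hends hfar
    rcases edge_eq_or_eq_of_mem_rhombus hiso hrh hδ hcov hseg with h | h
    · exact absurd (h.trans (Subtype.ext hde)) hne''
    · exact h

end Sides

end Literature.Probability.Percolation

end
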